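import Literature.Probability.Percolation.ArmSeparationProofs
import Literature.Probability.Percolation.ArmEventsAPrioriPoly
import HarnessLib

/-!
# Well-separated four-arm events and their gluing (Kesten's fences, `j = 4`, alternating colours)

Topic: Probability / Percolation; family `crit-perc` (critical site percolation `P_{1/2}` on the
triangular lattice `𝕋 = triGraph`). This file is the `j = 4` analogue of `ArmSeparation.lean` +
`ArmSeparationGlue.lean` (which treat `j = 2`): it DEFINES the well-separated ("fenced", with
Kesten's free spaces) four-arm event with alternating colours in the hexagonal annuli of
`armEvent`, a one-cone RSW gluing construction, and PROVES the two deterministic gluing statements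
behind Nolin's Prop. 12 [arXiv 0711.4948: Prop. 11] for four arms — extendability and gluing across
scales. The probabilistic half (generalised FKG, RSW, quasi-multiplicativity of
`π₄ = critFourArmProb` at `p = 1/2` from a four-arm separation hypothesis, and the resulting
reduction of `Literature.Probability.Percolation.fourArm_exponent`, Smirnov–Werner 2001, Thm. 4,
`j = 4`) is `ArmSeparationFourArmProofs.lean`. Everything here is proved; no named facts are
introduced.

## Contents (namespace `Literature.Probability.Percolation`)

* `readFrame i b ω = rotConfig i {v | v ∈ ω ↔ b}` — the configuration read in colour `b` in the
  `i`-th rotated frame (`ρ = triRotIso`, rotation by `60°`); it preserves `P_{1/2}`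
  (`real_preimage_readFrame`), transports locality (`determinedBy_preimage_readFrame`) and is
  monotone / antitone for `b = true / false`.
* `triCone = {0 < x₀, x₁ < 0, 0 < x₀ + x₁}` — the open cone over side `0` of the hexagons
  `∂Λ_N` (`Λ_N = triBall N`); on it `|·|_𝕋 = x₀`; its six rotated copies are pairwise disjoint
  (`rot_sector_injective`, `ArmEventsAPrioriPoly.lean`).
* `sepOpenArmIn X n N` — the fenced open arm landing on the right of `ArmSeparation.lean`
  (`sepOpenArm n N`, Nolin's `Ã̃` for one arm, `η = η' = 1/64`) with all its paths confined to the
  set of sites `X` (`sepOpenArmIn_univ`: `X = univ` gives `sepOpenArm`); its cone-shaped support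
  `sepConeSupport n N` (off the closed annulus the event only looks at sites of `triCone`;
  `determinedBy_sepOpenArmIn`, `4 ≤ n ≤ N`).
* `sepArmAt i b X n N` — a fenced arm of colour `b` landing on the middle halves of the `i`-th
  sides, confined to `X`; `sepArmPair i b n N` — two DISJOINT such arms on the opposite sides `i`,
  `i + 3`; `sepFourArm n N = sepArmPair 0 true n N ∩ sepArmPair 1 false n N` — **the well-separated
  four-arm event with alternating colours** (open arms landing on sides `0`, `3`, closed arms on
  sides `1`, `4`); monotonicity and locality of these events.
* `fourGlueBox q k`, `fourGluePiece q k` (`k < 73`), `fourGlueExt q` (first `39` pieces),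
  `fourGlue q` (all `73`) — the gluing construction at scale `q` between `∂Λ_{64q}` and
  `∂Λ_{512(q+1)}` inside ONE cone: `33` thin boxes over the rows of the outer free spaces at scale
  `64q`, a staircase of tubes and boxes following the cone, a tube and `33` boxes over the rows of
  the inner free spaces at scale `512(q+1)`; all boxes have aspect ratio `≤ 49` and lie in
  `glueRegion q = {64q < x₀ < 512(q+1)} ∩ triCone` (`fourGlueBox_subset`).
* `sepOpenArmIn_glue_core`, `sepOpenArmIn_glueExt_path`, `sepOpenArmIn_glue_path` — the
  deterministic gluing in the frame of side `0` (`PathIn.relay` at ten junctions,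
  `exists_glueSlab` at the two free spaces).
* `glueZone q n₁ n₃ i X X'`, `glueZone_disjoint` — the zones of the glued arms in the original
  frame and their pairwise disjointness for different sides; `sepArmAt_glue_path`,
  `sepArmAt_glueExt_path` — one glued / extended arm of colour `b` on side `i`;
  `mem_armEvent_of_disjointPaths` — arms in pairwise disjoint zones realise `armEvent`.
* `fourGlueFrames q`, `fourGlueExtFrames q` and the two gluing theorems
  `sepFourArm_glue_subset : sepFourArm n₁ (64q) ∩ fourGlueFrames q ∩ sepFourArm (512(q+1)) n₃ ⊆
  armEvent ![true, false, true, false] n₁ n₃` and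
  `sepFourArm_glueExt_subset : sepFourArm n₁ (64q) ∩ fourGlueExtFrames q ⊆
  armEvent ![true, false, true, false] n₁ (512(q+1) - 1)`.

## Design choices and faithfulness

* As in `ArmSeparation.lean`: hexagonal annuli instead of Nolin's rhombi, `η = 1/64`, landing
  sequences "middle halves of sides", free spaces off the annulus, and the relaxation of Nolin's
  arm-with-attaching-paths to an open connection between the two free spaces; every configuration
  of Nolin's `Ã̃^{η,I/η',I'}_{4,BWBW}` (with our landing sequence) lies in `sepFourArm`.
* Arms of the same colour must be disjoint for the four-arm event; this is expressed by confining
  each arm to a set of sites (`sepOpenArmIn X`) and asking the two sets to be disjoint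
  (`sepArmPair`); arms of different colours are disjoint automatically (`disjoint_inter_colour`).
* The gluing tubes of `ArmSeparationGlue.lean` (`sepGlue`) occupy two of the six cones, so four
  rotated copies would overlap; the construction here stays in one open cone, where the graph norm
  is the coordinate `x₀`, so that the copies in the frames `0, 1, 3, 4` are pairwise disjoint and
  disjoint from the free spaces of the other arms (`glueZone_disjoint`).
* The cyclic order of the colours is alternating (`BWBW` on sides `0, 1, 3, 4`). The tree's
  `armEvent ![true, false, true, false]` does not prescribe the cyclic arrangement (alternating or
  adjacent); the comparison of `P_{1/2}(sepFourArm n N)` with `critFourArmProb n N` (Nolin's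
  separation theorem, Thm. 11, together with colour switching, §5.1) is NOT proved here and enters
  `ArmSeparationFourArmProofs.lean` as an explicit hypothesis.

## References

* P. Nolin, *Near-critical percolation in two dimensions*, Electron. J. Probab. 13 (2008),
  1562–1623, §4.2 (free spaces, landing sequences, the events `Ã̃`), §4.3 (Thm. 11, Prop. 12,
  Lemma 13) [arXiv 0711.4948: Thm. 10, Prop. 11, Lemma 12; EJP number = arXiv number + 1, as in
  `ArmExponentsTwoArm.lean`]. [Nolin2008]
* H. Kesten, *Scaling relations for 2D-percolation*, Comm. Math. Phys. 109 (1987), 109–156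
  (fences, well-separated arms, extension of arms; cited after Nolin 2008, §4.2). [Kesten1987]
* S. Smirnov, W. Werner, *Critical exponents for two-dimensional percolation*, Math. Res. Lett. 8
  (2001), 729–744, §4 (10) and §4.2 (approximate multiplicativity for `j` arms), Rem. 2 (colour
  exchange). [SmirnovWernerMRL2001]

Mathlib search: Mathlib has no percolation, arm events or RSW theory (`rg -i "percolation|arm
event|Russo-Seymour"` in Mathlib: nothing relevant); used from Mathlib: `Set`/`Finset` API
(`Set.image_preimage_inter`, `Set.disjoint_left`), `SimpleGraph.Walk.toPath`, `Matrix.vecCons`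
notation. Tree: `sepOpenArm`, `sepLanding`, `sepInnerFence`, `sepOuterFence`, `sepJoinRegion`,
`OpenVCrossThrough`, `triAnnulusSet` (`ArmSeparation.lean`); `PathIn.relay`, `exists_glueSlab`,
`PathIn.exists_arm_of_triNorm_le`, `triNorm_le_of_mem_sepInnerFence`,
`lt_triNorm_of_mem_sepOuterFence` (`ArmSeparationGlue.lean`); `rotConfig`, `rot_apply_formula`,
`triNorm_rot`, `real_preimage_rotConfig`, `determinedBy_preimage_rotConfig`,
`setOf_mem_iff_true/false` (`ArmSeparationRotate.lean`); `rot_sector_injective`,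
`pathIn_of_rotConfig_colour`, `triSitePercolation_half_real_preimage_colour`,
`determinedBy_preimage_colour` (`ArmEventsAPrioriPoly.lean`); `triStrip`, `triHCross`,
`triVCross`, `triStripFinset` (`TriRSWChaining.lean`); `triAnnSet` (`ArmSeparationReroute.lean`);
`armEvent` (`ArmEvents.lean`); `triNorm_eq_apply_zero`, `triNorm_lt_iff_lin` (`ArmEventsAPriori.lean`);
`DeterminedBy` API (`PercolationEvents.lean`, `SiteMonotonicity.lean`, `SiteHarrisChain.lean`).
-/

noncomputable section

open MeasureTheory Set

namespace Literature.Probability.Percolation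

open LatticeModels

/-! ### Rotated frames read in a colour -/

/-- **The configuration read in colour `b` in the `i`-th rotated frame**:
`readFrame i b ω = rotConfig i {v | v ∈ ω ↔ b} = {v | ρ^i v ∈ ω ↔ b}` (`ρ = triRotIso`, the
rotation by `60°`). An open object of `readFrame i b ω` at side `0` is an object of colour `b` of
`ω` at side `i` (`pathIn_of_rotConfig_colour`). Both operations preserve `P_{1/2}` (lattice
symmetry; colour exchange at `p = 1/2`, Smirnov–Werner 2001, Rem. 2). [cite: SmirnovWernerMRL2001, Rem. 2] -/
def readFrame (i : ℕ) (b : Bool) (ω : SiteConfig (Site 2)) : SiteConfig (Site 2) :=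
  rotConfig i {v : Site 2 | v ∈ ω ↔ b}

/-- Membership in the re-read configuration. [folklore] -/
@[simp] theorem mem_readFrame {i : ℕ} {b : Bool} {ω : SiteConfig (Site 2)} {v : Site 2} :
    v ∈ readFrame i b ω ↔ (triRotIsoPow i v ∈ ω ↔ b) := by
  rw [readFrame, mem_rotConfig]; rfl

/-- `readFrame i b` is the composite of reading in colour `b` and `rotConfig i`. [folklore] -/
theorem preimage_readFrame (i : ℕ) (b : Bool) (E : Set (SiteConfig (Site 2))) :
    readFrame i b ⁻¹' E =
      (fun ω : SiteConfig (Site 2) => {v : Site 2 | v ∈ ω ↔ b}) ⁻¹' (rotConfig i ⁻¹' E) :=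
  rfl

/-- **`readFrame` preserves `P_{1/2}`** (rotation invariance and self-duality of `p = 1/2`). [cite: SmirnovWernerMRL2001, Rem. 2] -/
theorem real_preimage_readFrame (i : ℕ) (b : Bool) (E : Set (SiteConfig (Site 2))) :
    (triSitePercolation half).real (readFrame i b ⁻¹' E) = (triSitePercolation half).real E := by
  rw [preimage_readFrame, triSitePercolation_half_real_preimage_colour, real_preimage_rotConfig]

/-- Locality is transported by `readFrame`: if `E` is determined by `F` then `readFrame i b ⁻¹' E`
is determined by `ρ^i(F)`. [folklore] -/
theorem determinedBy_preimage_readFrame (i : ℕ) (b : Bool) {E : Set (SiteConfig (Site 2))}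
    {F : Set (Site 2)} (hE : DeterminedBy E F) :
    DeterminedBy (readFrame i b ⁻¹' E) (triRotIsoPow i '' F) := by
  rw [preimage_readFrame]
  exact determinedBy_preimage_colour b (determinedBy_preimage_rotConfig i hE)

/-- Reading in colour `true` is just rotating. [folklore] -/
theorem readFrame_true (i : ℕ) (ω : SiteConfig (Site 2)) : readFrame i true ω = rotConfig i ω := by
  rw [readFrame, setOf_mem_iff_true]

/-- Reading in colour `false` is rotating the colour-exchanged configuration. [folklore] -/
theorem readFrame_false (i : ℕ) (ω : SiteConfig (Site 2)) : readFrame i false ω = rotConfig i ωᶜ := by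
  rw [readFrame, setOf_mem_iff_false]

/-- Reading in colour `true` is monotone. [folklore] -/
theorem readFrame_true_mono (i : ℕ) {ω ω' : SiteConfig (Site 2)} (h : ω ≤ ω') :
    readFrame i true ω ≤ readFrame i true ω' := by
  intro v hv
  rw [readFrame_true, mem_rotConfig] at hv ⊢
  exact h hv

/-- Reading in colour `false` is antitone. [folklore] -/
theorem readFrame_false_anti (i : ℕ) {ω ω' : SiteConfig (Site 2)} (h : ω ≤ ω') :
    readFrame i false ω' ≤ readFrame i false ω := by
  intro v hv
  rw [readFrame_false, mem_rotConfig] at hv ⊢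
  exact fun h' => hv (h h')

/-- The preimage of an increasing event under reading in colour `true` is increasing. [folklore] -/
theorem IsUpperSet.preimage_readFrame_true (i : ℕ) {E : Set (SiteConfig (Site 2))}
    (hE : IsUpperSet E) : IsUpperSet (readFrame i true ⁻¹' E) :=
  fun _ _ h hmem => hE (readFrame_true_mono i h) hmem

/-- The preimage of an increasing event under reading in colour `false` is decreasing. [folklore] -/
theorem IsUpperSet.preimage_readFrame_false (i : ℕ) {E : Set (SiteConfig (Site 2))}
    (hE : IsUpperSet E) : IsLowerSet (readFrame i false ⁻¹' E) :=
  fun _ _ h hmem => hE (readFrame_false_anti i h) hmem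

/-- The set of sites of colour `b` of `ω`, pulled back to the `i`-th frame, is `readFrame i b ω`. [folklore] -/
theorem preimage_rot_colourSet (i : ℕ) (b : Bool) (ω : SiteConfig (Site 2)) :
    (triRotIsoPow i) ⁻¹' {v : Site 2 | v ∈ ω ↔ b} = readFrame i b ω := by
  ext v; rw [mem_preimage, mem_setOf_eq, mem_readFrame]

/-! ### The open cone over side `0` and the graph norm there -/

/-- The **open cone (sector) over side `0`** of the hexagons `∂Λ_N`: `{0 < x₀, x₁ < 0, 0 < x₀ + x₁}`,
the cone spanned by the right side `{x₀ = N, -N < x₁ < 0}` minus its two corner rays; its six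
rotated copies `ρ^a(triCone)`, `a < 6`, are pairwise disjoint (`rot_sector_injective`). [folklore] -/
def triCone : Set (Site 2) := {v | 0 < v 0 ∧ v 1 < 0 ∧ 0 < v 0 + v 1}

/-- Membership in the open cone, unfolded. [folklore] -/
@[simp] theorem mem_triCone {v : Site 2} : v ∈ triCone ↔ 0 < v 0 ∧ v 1 < 0 ∧ 0 < v 0 + v 1 := Iff.rfl

/-! ### Fenced open arms confined to a set of sites -/

/-- **The fenced open arm landing on the right, inside `X`**: the event `sepOpenArm n N` of
`ArmSeparation.lean` (Nolin's `Ã̃` for one open arm, `η = η' = 1/64`, landing on the middle halves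
of the right sides of `∂Λ_n`, `∂Λ_N`, relaxed to the open connection between the two free spaces)
with all its paths — the two vertical fence crossings and the joining path — required to run
through sites of `X`. For `X = univ` this is `sepOpenArm n N` (`sepOpenArmIn_univ`); the set `X`
records the sites an arm uses, so that disjointness of several arms of the same colour can be
expressed (`sepArmPair`). [cite: Nolin2008, §4.2, well-separated arm events (arXiv 0711.4948: Def. 6–8)] -/
def sepOpenArmIn (X : Set (Site 2)) (n N : ℕ) : Set (SiteConfig (Site 2)) :=
  {ω | ∃ z z' u u' : Site 2, z ∈ sepLanding N ∧ z' ∈ sepLanding n ∧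
    OpenVCrossThrough (sepInnerFence n z' ∩ X) (z' 1 - (n / 64 : ℕ)) (z' 1 + (n / 64 : ℕ)) ω u ∧
    OpenVCrossThrough (sepOuterFence N z ∩ X) (z 1 - (N / 64 : ℕ)) (z 1 + (N / 64 : ℕ)) ω u' ∧
    PathIn triGraph (sepJoinRegion n N z z' ∩ X ∩ ω) u u'}

/-- With no confinement the event is the fenced open arm of `ArmSeparation.lean`. [cite: Nolin2008, §4.2, well-separated arm events (arXiv 0711.4948: Def. 6–8)] -/
theorem sepOpenArmIn_univ (n N : ℕ) : sepOpenArmIn univ n N = sepOpenArm n N := by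
  simp only [sepOpenArmIn, sepOpenArm, inter_univ]

/-- Confinement is monotone in the confining set. [folklore] -/
theorem sepOpenArmIn_mono {X X' : Set (Site 2)} (h : X ⊆ X') (n N : ℕ) :
    sepOpenArmIn X n N ⊆ sepOpenArmIn X' n N := by
  rintro ω ⟨z, z', u, u', hz, hz', ⟨b, t, hb, ht, p₁, p₂⟩, ⟨b', t', hb', ht', p₃, p₄⟩, p₅⟩
  have m1 : sepInnerFence n z' ∩ X ∩ ω ⊆ sepInnerFence n z' ∩ X' ∩ ω :=
    fun v hv => ⟨⟨hv.1.1, h hv.1.2⟩, hv.2⟩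
  have m2 : sepOuterFence N z ∩ X ∩ ω ⊆ sepOuterFence N z ∩ X' ∩ ω :=
    fun v hv => ⟨⟨hv.1.1, h hv.1.2⟩, hv.2⟩
  have m3 : sepJoinRegion n N z z' ∩ X ∩ ω ⊆ sepJoinRegion n N z z' ∩ X' ∩ ω :=
    fun v hv => ⟨⟨hv.1.1, h hv.1.2⟩, hv.2⟩
  exact ⟨z, z', u, u', hz, hz', ⟨b, t, hb, ht, p₁.mono m1, p₂.mono m1⟩,
    ⟨b', t', hb', ht', p₃.mono m2, p₄.mono m2⟩, p₅.mono m3⟩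

/-- A confined fenced arm is a fenced arm. [cite: Nolin2008, §4.2, well-separated arm events (arXiv 0711.4948: Def. 6–8)] -/
theorem sepOpenArmIn_subset_sepOpenArm (X : Set (Site 2)) (n N : ℕ) :
    sepOpenArmIn X n N ⊆ sepOpenArm n N := by
  rw [← sepOpenArmIn_univ]
  exact sepOpenArmIn_mono (subset_univ X) n N

/-- The confined fenced open arm is an increasing event. [cite: Nolin2008, §4.2, well-separated arm events (arXiv 0711.4948: Def. 6–8)] -/
theorem isUpperSet_sepOpenArmIn (X : Set (Site 2)) (n N : ℕ) : IsUpperSet (sepOpenArmIn X n N) := by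
  rintro ω ω' hle ⟨z, z', u, u', hz, hz', ⟨b, t, hb, ht, p₁, p₂⟩, ⟨b', t', hb', ht', p₃, p₄⟩, p₅⟩
  exact ⟨z, z', u, u', hz, hz',
    ⟨b, t, hb, ht, p₁.mono fun v hv => ⟨hv.1, hle hv.2⟩, p₂.mono fun v hv => ⟨hv.1, hle hv.2⟩⟩,
    ⟨b', t', hb', ht', p₃.mono fun v hv => ⟨hv.1, hle hv.2⟩, p₄.mono fun v hv => ⟨hv.1, hle hv.2⟩⟩,
    p₅.mono fun v hv => ⟨hv.1, hle hv.2⟩⟩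

/-- **Normalisation**: a fenced arm confined to `X` is confined to `X ∩ ω` (its paths are open). [folklore] -/
theorem mem_sepOpenArmIn_inter_self {X : Set (Site 2)} {n N : ℕ} {ω : SiteConfig (Site 2)}
    (h : ω ∈ sepOpenArmIn X n N) : ω ∈ sepOpenArmIn (X ∩ ω) n N := by
  obtain ⟨z, z', u, u', hz, hz', ⟨b, t, hb, ht, p₁, p₂⟩, ⟨b', t', hb', ht', p₃, p₄⟩, p₅⟩ := h
  have m : ∀ F : Set (Site 2), F ∩ X ∩ ω ⊆ F ∩ (X ∩ ω) ∩ ω :=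
    fun F v hv => ⟨⟨hv.1.1, hv.1.2, hv.2⟩, hv.2⟩
  exact ⟨z, z', u, u', hz, hz', ⟨b, t, hb, ht, p₁.mono (m _), p₂.mono (m _)⟩,
    ⟨b', t', hb', ht', p₃.mono (m _), p₄.mono (m _)⟩, p₅.mono (m _)⟩

/-! ### The cone-shaped support of the fenced arm events -/

/-- **The support of the fenced arm events, sharpened.** The sites on which `sepOpenArmIn X n N`
depends lie in `{n - n/8 ≤ |·|_𝕋 ≤ N + N/8}`, and those of them off the closed annulus
`{n ≤ |·|_𝕋 ≤ N}` (free spaces and attaching balls) lie in the open cone `triCone` over side `0`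
(for `4 ≤ n ≤ N`; compare `sepSupportSet`, which only records `x₀ > 0`). [cite: Nolin2008, §4.2, free spaces (arXiv 0711.4948: Def. 6)] -/
def sepConeSupport (n N : ℕ) : Set (Site 2) :=
  {v | (n : ℤ) - (n / 8 : ℕ) ≤ triNorm v ∧ triNorm v ≤ (N : ℤ) + (N / 8 : ℕ) ∧
    ((triNorm v < n ∨ (N : ℤ) < triNorm v) → v ∈ triCone)}

/-- Membership in `sepConeSupport`, unfolded. [cite: Nolin2008, §4.2, free spaces (arXiv 0711.4948: Def. 6)] -/
@[simp] theorem mem_sepConeSupport {n N : ℕ} {v : Site 2} :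
    v ∈ sepConeSupport n N ↔ (n : ℤ) - (n / 8 : ℕ) ≤ triNorm v ∧ triNorm v ≤ (N : ℤ) + (N / 8 : ℕ) ∧
      ((triNorm v < n ∨ (N : ℤ) < triNorm v) → (0 < v 0 ∧ v 1 < 0 ∧ 0 < v 0 + v 1)) :=
  Iff.rfl

/-- An inner free space lies in the cone support (`4 ≤ n ≤ N`). [cite: Nolin2008, §4.2, free spaces on the internal boundary (arXiv 0711.4948: Def. 6–7)] -/
theorem sepInnerFence_subset_sepConeSupport {n N : ℕ} (h4 : 4 ≤ n) (hnN : n ≤ N) {z' : Site 2}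
    (hz' : z' ∈ sepLanding n) : sepInnerFence n z' ⊆ sepConeSupport n N := by
  intro v hv
  have hvn := triNorm_le_of_mem_sepInnerFence hz' hv
  rw [mem_sepInnerFence] at hv
  rw [mem_sepLanding] at hz'
  have h0 : v 0 ≤ triNorm v := le_triNorm_iff_lin.2 (Or.inl le_rfl)
  have hnN' : (n : ℤ) ≤ N := by exact_mod_cast hnN
  rw [mem_sepConeSupport]
  refine ⟨by omega, by omega, fun _ => ⟨by omega, by omega, by omega⟩⟩

/-- An outer free space lies in the cone support (`4 ≤ n ≤ N`). [cite: Nolin2008, §4.2, free spaces (arXiv 0711.4948: Def. 6)] -/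
theorem sepOuterFence_subset_sepConeSupport {n N : ℕ} (h4 : 4 ≤ n) (hnN : n ≤ N) {z : Site 2}
    (hz : z ∈ sepLanding N) : sepOuterFence N z ⊆ sepConeSupport n N := by
  intro v hv
  rw [mem_sepOuterFence] at hv
  rw [mem_sepLanding] at hz
  have hnN' : (n : ℤ) ≤ N := by exact_mod_cast hnN
  have hc : 0 < v 0 ∧ v 1 < 0 ∧ 0 < v 0 + v 1 := ⟨by omega, by omega, by omega⟩
  have hn : triNorm v = v 0 := triNorm_eq_apply_zero hc.2.1.le hc.2.2.le
  rw [mem_sepConeSupport, hn]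
  exact ⟨by omega, by omega, fun _ => hc⟩

/-- The region of an arm and its attaching paths lies in the cone support (`4 ≤ n ≤ N`). [cite: Nolin2008, §4.2, free spaces on the internal boundary (arXiv 0711.4948: Def. 6–7)] -/
theorem sepJoinRegion_subset_sepConeSupport {n N : ℕ} (h4 : 4 ≤ n) (hnN : n ≤ N) {z z' : Site 2}
    (hz : z ∈ sepLanding N) (hz' : z' ∈ sepLanding n) :
    sepJoinRegion n N z z' ⊆ sepConeSupport n N := by
  rw [mem_sepLanding] at hz hz'
  have hnN' : (n : ℤ) ≤ N := by exact_mod_cast hnN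
  rintro v ((hv | hv) | hv)
  · rw [mem_triAnnulusSet] at hv
    rw [mem_sepConeSupport]
    exact ⟨by omega, by omega, fun h => by omega⟩
  · rw [mem_triOpenBall, triNorm_lt_iff_lin] at hv
    simp only [Pi.sub_apply] at hv
    have hc : 0 < v 0 ∧ v 1 < 0 ∧ 0 < v 0 + v 1 := ⟨by omega, by omega, by omega⟩
    have hn : triNorm v = v 0 := triNorm_eq_apply_zero hc.2.1.le hc.2.2.le
    rw [mem_sepConeSupport, hn]
    exact ⟨by omega, by omega, fun _ => hc⟩
  · rw [mem_triOpenBall, triNorm_lt_iff_lin] at hv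
    simp only [Pi.sub_apply] at hv
    have hc : 0 < v 0 ∧ v 1 < 0 ∧ 0 < v 0 + v 1 := ⟨by omega, by omega, by omega⟩
    have hn : triNorm v = v 0 := triNorm_eq_apply_zero hc.2.1.le hc.2.2.le
    rw [mem_sepConeSupport, hn]
    exact ⟨by omega, by omega, fun _ => hc⟩

/-- **Confinement to the support**: a fenced arm confined to `X` is confined to
`X ∩ sepConeSupport n N` (`4 ≤ n ≤ N`). [cite: Nolin2008, §4.2, free spaces (arXiv 0711.4948: Def. 6)] -/
theorem mem_sepOpenArmIn_inter_support {X : Set (Site 2)} {n N : ℕ} (h4 : 4 ≤ n) (hnN : n ≤ N)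
    {ω : SiteConfig (Site 2)} (h : ω ∈ sepOpenArmIn X n N) :
    ω ∈ sepOpenArmIn (X ∩ sepConeSupport n N) n N := by
  obtain ⟨z, z', u, u', hz, hz', ⟨b, t, hb, ht, p₁, p₂⟩, ⟨b', t', hb', ht', p₃, p₄⟩, p₅⟩ := h
  have hI := sepInnerFence_subset_sepConeSupport h4 hnN hz'
  have hO := sepOuterFence_subset_sepConeSupport h4 hnN hz
  have hJ := sepJoinRegion_subset_sepConeSupport h4 hnN hz hz'
  have m : ∀ {F : Set (Site 2)}, F ⊆ sepConeSupport n N →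
      F ∩ X ∩ ω ⊆ F ∩ (X ∩ sepConeSupport n N) ∩ ω :=
    fun hF v hv => ⟨⟨hv.1.1, hv.1.2, hF hv.1.1⟩, hv.2⟩
  exact ⟨z, z', u, u', hz, hz', ⟨b, t, hb, ht, p₁.mono (m hI), p₂.mono (m hI)⟩,
    ⟨b', t', hb', ht', p₃.mono (m hO), p₄.mono (m hO)⟩, p₅.mono (m hJ)⟩

/-- The confined fenced arm only depends on the sites of the cone support: restricting the
configuration to `sepConeSupport n N` does not change the event (`4 ≤ n ≤ N`). [cite: Nolin2008, §4.2, well-separated arm events (arXiv 0711.4948: Def. 6–8)] -/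
theorem mem_sepOpenArmIn_iff_inter {X : Set (Site 2)} {n N : ℕ} (h4 : 4 ≤ n) (hnN : n ≤ N)
    (ω : SiteConfig (Site 2)) :
    ω ∈ sepOpenArmIn X n N ↔ ω ∩ sepConeSupport n N ∈ sepOpenArmIn X n N := by
  constructor
  · intro h
    obtain ⟨z, z', u, u', hz, hz', ⟨b, t, hb, ht, p₁, p₂⟩, ⟨b', t', hb', ht', p₃, p₄⟩, p₅⟩ :=
      mem_sepOpenArmIn_inter_support h4 hnN h
    have m : ∀ F : Set (Site 2), F ∩ (X ∩ sepConeSupport n N) ∩ ω ⊆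
        F ∩ X ∩ (ω ∩ sepConeSupport n N) :=
      fun F v hv => ⟨⟨hv.1.1, hv.1.2.1⟩, hv.2, hv.1.2.2⟩
    exact ⟨z, z', u, u', hz, hz', ⟨b, t, hb, ht, p₁.mono (m _), p₂.mono (m _)⟩,
      ⟨b', t', hb', ht', p₃.mono (m _), p₄.mono (m _)⟩, p₅.mono (m _)⟩
  · intro h
    exact isUpperSet_sepOpenArmIn X n N (show ω ∩ sepConeSupport n N ≤ ω from inter_subset_left) h

/-- **Locality of the confined fenced arm**: `sepOpenArmIn X n N` is determined by the sites of
`sepConeSupport n N` (`4 ≤ n ≤ N`). [cite: Nolin2008, §4.2, well-separated arm events (arXiv 0711.4948: Def. 6–8)] -/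
theorem determinedBy_sepOpenArmIn (X : Set (Site 2)) {n N : ℕ} (h4 : 4 ≤ n) (hnN : n ≤ N) :
    DeterminedBy (sepOpenArmIn X n N) (sepConeSupport n N) := by
  rw [determinedBy_iff]
  intro ω ω' hω
  rw [mem_sepOpenArmIn_iff_inter h4 hnN ω, mem_sepOpenArmIn_iff_inter h4 hnN ω', hω]

/-! ### Fenced arms of either colour landing on any side; the well-separated four-arm event -/

/-- **A fenced arm of colour `b` landing on side `i`, confined to `X`**: the configuration read in
colour `b` in the `i`-th rotated frame has a fenced open arm landing on the right (side `0`) whose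
paths run through `(ρ^i)⁻¹(X)`, i.e. `ω` has a fenced arm of colour `b` (its free spaces crossed
by colour `b`) landing on the middle halves of the `i`-th sides of `∂Λ_n`, `∂Λ_N`, all of whose
paths run through `X` (Nolin 2008, §4.2, the events `Ã̃` for one arm of colour `σ_i` with landing
sequence on a prescribed side). [cite: Nolin2008, §4.2, well-separated arm events with landing areas (arXiv 0711.4948: Def. 6–8)] -/
def sepArmAt (i : ℕ) (b : Bool) (X : Set (Site 2)) (n N : ℕ) : Set (SiteConfig (Site 2)) :=
  readFrame i b ⁻¹' sepOpenArmIn ((triRotIsoPow i) ⁻¹' X) n N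

/-- Membership in `sepArmAt`, unfolded. [cite: Nolin2008, §4.2, well-separated arm events with landing areas (arXiv 0711.4948: Def. 6–8)] -/
theorem mem_sepArmAt {i : ℕ} {b : Bool} {X : Set (Site 2)} {n N : ℕ} {ω : SiteConfig (Site 2)} :
    ω ∈ sepArmAt i b X n N ↔ readFrame i b ω ∈ sepOpenArmIn ((triRotIsoPow i) ⁻¹' X) n N :=
  Iff.rfl

/-- **Two disjoint fenced arms of colour `b` landing on the opposite sides `i`, `i + 3`.** There
are disjoint sets of sites `X`, `Y` carrying a fenced arm of colour `b` landing on side `i` and a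
fenced arm of colour `b` landing on side `i + 3` (arms of the same colour must be required to be
disjoint; arms of different colours are disjoint automatically). [cite: Nolin2008, §4.2, well-separated arm events with landing areas (arXiv 0711.4948: Def. 6–8)] -/
def sepArmPair (i : ℕ) (b : Bool) (n N : ℕ) : Set (SiteConfig (Site 2)) :=
  {ω | ∃ X Y : Set (Site 2), Disjoint X Y ∧ ω ∈ sepArmAt i b X n N ∧ ω ∈ sepArmAt (i + 3) b Y n N}

/-- **The well-separated four-arm event with alternating colours** (the `j = 4`,
`σ = BWBW`-instance of Nolin's `Ã̃^{η,I/η',I'}_{j,σ}(n, N)`, 2008, §4.2, with `η = η' = 1/64` and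
the landing sequences "middle halves of sides `0`, `1`, `3`, `4`" of the hexagons `∂Λ_n`, `∂Λ_N`,
relaxed as in `sepOpenArm`): two disjoint fenced open arms landing on sides `0` and `3` and two
disjoint fenced closed arms landing on sides `1` and `4`; in cyclic order the colours alternate.
This is the shape in which four arms are glued across scales (`sepFourArm_glue_subset`). [cite: Nolin2008, §4.2, well-separated arm events with landing areas (arXiv 0711.4948: Def. 6–8)] -/
def sepFourArm (n N : ℕ) : Set (SiteConfig (Site 2)) := sepArmPair 0 true n N ∩ sepArmPair 1 false n N

/-- `sepArmAt i true X` is increasing. [folklore] -/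
theorem isUpperSet_sepArmAt_true (i : ℕ) (X : Set (Site 2)) (n N : ℕ) :
    IsUpperSet (sepArmAt i true X n N) :=
  IsUpperSet.preimage_readFrame_true i (isUpperSet_sepOpenArmIn _ n N)

/-- `sepArmAt i false X` is decreasing. [folklore] -/
theorem isLowerSet_sepArmAt_false (i : ℕ) (X : Set (Site 2)) (n N : ℕ) :
    IsLowerSet (sepArmAt i false X n N) :=
  IsUpperSet.preimage_readFrame_false i (isUpperSet_sepOpenArmIn _ n N)

/-- Two disjoint fenced open arms form an increasing event. [folklore] -/
theorem isUpperSet_sepArmPair_true (i n N : ℕ) : IsUpperSet (sepArmPair i true n N) := by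
  rintro ω ω' hle ⟨X, Y, hXY, hX, hY⟩
  exact ⟨X, Y, hXY, isUpperSet_sepArmAt_true i X n N hle hX, isUpperSet_sepArmAt_true _ Y n N hle hY⟩

/-- Two disjoint fenced closed arms form a decreasing event. [folklore] -/
theorem isLowerSet_sepArmPair_false (i n N : ℕ) : IsLowerSet (sepArmPair i false n N) := by
  rintro ω ω' hle ⟨X, Y, hXY, hX, hY⟩
  exact ⟨X, Y, hXY, isLowerSet_sepArmAt_false i X n N hle hX, isLowerSet_sepArmAt_false _ Y n N hle hY⟩

/-- Locality of `sepArmAt`: determined by `ρ^i(sepConeSupport n N)` (`4 ≤ n ≤ N`). [folklore] -/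
theorem determinedBy_sepArmAt (i : ℕ) (b : Bool) (X : Set (Site 2)) {n N : ℕ} (h4 : 4 ≤ n)
    (hnN : n ≤ N) : DeterminedBy (sepArmAt i b X n N) (triRotIsoPow i '' sepConeSupport n N) :=
  determinedBy_preimage_readFrame i b (determinedBy_sepOpenArmIn _ h4 hnN)

/-- Locality of `sepArmPair`: determined by `ρ^i(S) ∪ ρ^{i+3}(S)`, `S = sepConeSupport n N`
(`4 ≤ n ≤ N`). [folklore] -/
theorem determinedBy_sepArmPair (i : ℕ) (b : Bool) {n N : ℕ} (h4 : 4 ≤ n) (hnN : n ≤ N) :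
    DeterminedBy (sepArmPair i b n N)
      (triRotIsoPow i '' sepConeSupport n N ∪ triRotIsoPow (i + 3) '' sepConeSupport n N) := by
  have h : sepArmPair i b n N = ⋃ X : Set (Site 2), ⋃ Y : Set (Site 2), ⋃ (_ : Disjoint X Y),
      (sepArmAt i b X n N ∩ sepArmAt (i + 3) b Y n N) := by
    ext ω
    simp only [sepArmPair, mem_setOf_eq, mem_iUnion, mem_inter_iff, exists_prop]
  rw [h]
  refine DeterminedBy.iUnion fun X => DeterminedBy.iUnion fun Y => DeterminedBy.iUnion fun _ => ?_
  exact ((determinedBy_sepArmAt i b X h4 hnN).mono subset_union_left).inter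
    ((determinedBy_sepArmAt (i + 3) b Y h4 hnN).mono subset_union_right)

/-! ### The one-cone gluing construction between the scales `64q` and `512(q+1)` -/

/-- **The boxes of the gluing construction at scale `q`** (`Q = q + 1`), all inside the open cone
`triCone` over side `0` and the open annulus `{64q < |·|_𝕋 < 512Q}`, listed as
`k ↦ (left column a, bottom row b, width m, height n)` of `[a, a+m] × [b, b+n]`:
* `k < 33`: the thin boxes `[64q+1, 80q+1] × [(k-48)q, (k-47)q]` over the rows met by the outer
  free spaces `[64q+1, 72q] × [t-q, t+q]`, `-48q ≤ t ≤ -16q`, at scale `64q` (crossed horizontally);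
* `33`: the tube `[72q, 80q] × [-49q, -14q]` (vertically); `34`: `[72q, 136q] × [-48q, -32q]`
  (horizontally); `35`: `[128q, 136q] × [-96q, -32q]` (vertically); `36`:
  `[128q, 264q] × [-96q, -64q]` (horizontally); `37`: `[256q, 264q] × [-192q, -64q]` (vertically);
  `38`: `[256q, 512Q-1] × [-192q, -128q]` (horizontally) — a staircase following the cone;
* `39`: the tube `[432Q-1, 440Q-1] × [-392Q-1, -1]` (vertically);
* `40 ≤ k < 73`: the boxes `[432Q-1, 512Q-1] × [8Q(k-88), 8Q(k-87)]` over the rows met by the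
  inner free spaces `[448Q, 512Q-1] × [t'-8Q, t'+8Q]`, `-384Q ≤ t' ≤ -128Q`, at scale `512Q`
  (horizontally).
Consecutive boxes cross each other transversally; all aspect ratios are at most `49`. (The finite
RSW gluing construction of Nolin 2008, proof of Prop. 12 [arXiv 0711.4948: Prop. 11]; Kesten 1987,
extension of arms through fences; here confined to one cone so that four rotated copies are
disjoint.) [cite: Nolin2008, §4.3 Prop. 12 (proof) (arXiv 0711.4948: Prop. 11)] -/
def fourGlueBox (q k : ℕ) : ℤ × ℤ × ℕ × ℕ :=
  if k < 33 then (64 * (q : ℤ) + 1, ((k : ℤ) - 48) * q, 16 * q, q)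
  else if k = 33 then (72 * (q : ℤ), -(49 * (q : ℤ)), 8 * q, 35 * q)
  else if k = 34 then (72 * (q : ℤ), -(48 * (q : ℤ)), 64 * q, 16 * q)
  else if k = 35 then (128 * (q : ℤ), -(96 * (q : ℤ)), 8 * q, 64 * q)
  else if k = 36 then (128 * (q : ℤ), -(96 * (q : ℤ)), 136 * q, 32 * q)
  else if k = 37 then (256 * (q : ℤ), -(192 * (q : ℤ)), 8 * q, 128 * q)
  else if k = 38 then (256 * (q : ℤ), -(192 * (q : ℤ)), 256 * q + 511, 64 * q)
  else if k = 39 then (432 * ((q : ℤ) + 1) - 1, -(392 * ((q : ℤ) + 1) + 1), 8 * (q + 1), 392 * (q + 1))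
  else (432 * ((q : ℤ) + 1) - 1, ((k : ℤ) - 88) * (8 * ((q : ℤ) + 1)), 80 * (q + 1), 8 * (q + 1))

/-- The boxes crossed vertically (the four tubes `k = 33, 35, 37, 39`); the others are crossed
horizontally. [cite: Nolin2008, §4.3 Prop. 12 (proof) (arXiv 0711.4948: Prop. 11)] -/
def fourGlueVert (k : ℕ) : Prop := k = 33 ∨ k = 35 ∨ k = 37 ∨ k = 39

/-- Being a tube index is decidable. [folklore] -/
instance (k : ℕ) : Decidable (fourGlueVert k) := by unfold fourGlueVert; infer_instance

/-- **The `k`-th piece of the gluing event at scale `q`**: the open crossing (vertical for the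
tubes, horizontal otherwise) of the `k`-th box `fourGlueBox q k`. [cite: Nolin2008, §4.3 Prop. 12 (proof) (arXiv 0711.4948: Prop. 11)] -/
def fourGluePiece (q k : ℕ) : Set (SiteConfig (Site 2)) :=
  if fourGlueVert k then
    triVCross (fourGlueBox q k).1 (fourGlueBox q k).2.1 (fourGlueBox q k).2.2.1 (fourGlueBox q k).2.2.2
  else triHCross (fourGlueBox q k).1 (fourGlueBox q k).2.1 (fourGlueBox q k).2.2.1 (fourGlueBox q k).2.2.2

/-- The sites of the `k`-th box. [cite: Nolin2008, §4.3 Prop. 12 (proof) (arXiv 0711.4948: Prop. 11)] -/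
def fourGluePieceFinset (q k : ℕ) : Finset (Site 2) :=
  triStripFinset (fourGlueBox q k).1 (fourGlueBox q k).2.1 (fourGlueBox q k).2.2.1 (fourGlueBox q k).2.2.2

/-- **The extension event at scale `q`**: the first `39` pieces (thin boxes and staircase), which
carry every vertical open crossing of an outer free space at scale `64q` to the column
`x₀ = 512Q - 1`, i.e. to graph norm `512Q - 1 ≥ 8 · 64q` (Nolin 2008, Prop. 12 (i),
extendability). [cite: Nolin2008, §4.3 Prop. 12 (proof) (arXiv 0711.4948: Prop. 11)] -/
def fourGlueExt (q : ℕ) : Set (SiteConfig (Site 2)) := ⋂ k ∈ Finset.range 39, fourGluePiece q k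

/-- **The gluing event at scale `q`**: all `73` pieces, which join every vertical open crossing
of an outer free space at scale `64q` to every vertical open crossing of an inner free space at
scale `512Q` inside the cone (Nolin 2008, Prop. 12 (ii), quasi-multiplicativity). [cite: Nolin2008, §4.3 Prop. 12 (proof) (arXiv 0711.4948: Prop. 11)] -/
def fourGlue (q : ℕ) : Set (SiteConfig (Site 2)) := ⋂ k ∈ Finset.range 73, fourGluePiece q k

/-- The sites of the extension event. [cite: Nolin2008, §4.3 Prop. 12 (proof) (arXiv 0711.4948: Prop. 11)] -/
def fourGlueExtFinset (q : ℕ) : Finset (Site 2) := (Finset.range 39).biUnion (fourGluePieceFinset q)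

/-- The sites of the gluing event. [cite: Nolin2008, §4.3 Prop. 12 (proof) (arXiv 0711.4948: Prop. 11)] -/
def fourGlueFinset (q : ℕ) : Finset (Site 2) := (Finset.range 73).biUnion (fourGluePieceFinset q)

/-- The gluing event refines the extension event. [folklore] -/
theorem fourGlue_subset_fourGlueExt (q : ℕ) : fourGlue q ⊆ fourGlueExt q := by
  intro ω hω
  simp only [fourGlue, fourGlueExt, mem_iInter, Finset.mem_range] at hω ⊢
  exact fun k hk => hω k (by omega)

/-- Each piece is determined by the sites of its box. [folklore] -/
theorem determinedBy_fourGluePiece (q k : ℕ) :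
    DeterminedBy (fourGluePiece q k) ↑(fourGluePieceFinset q k) := by
  unfold fourGluePiece fourGluePieceFinset
  split_ifs
  · exact determinedBy_triVCross _ _ _ _
  · exact determinedBy_triHCross _ _ _ _

/-- Each piece is increasing. [folklore] -/
theorem isUpperSet_fourGluePiece (q k : ℕ) : IsUpperSet (fourGluePiece q k) := by
  unfold fourGluePiece
  split_ifs
  · exact isUpperSet_triVCross _ _ _ _
  · exact isUpperSet_triHCross _ _ _ _

/-- The extension event is determined by its sites. [folklore] -/
theorem determinedBy_fourGlueExt (q : ℕ) : DeterminedBy (fourGlueExt q) ↑(fourGlueExtFinset q) := by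
  classical
  exact DeterminedBy.biInter_finset _ fun k _ => determinedBy_fourGluePiece q k

/-- The gluing event is determined by its sites. [folklore] -/
theorem determinedBy_fourGlue (q : ℕ) : DeterminedBy (fourGlue q) ↑(fourGlueFinset q) := by
  classical
  exact DeterminedBy.biInter_finset _ fun k _ => determinedBy_fourGluePiece q k

/-- The extension event is increasing. [folklore] -/
theorem isUpperSet_fourGlueExt (q : ℕ) : IsUpperSet (fourGlueExt q) :=
  isUpperSet_iInter₂ fun k _ => isUpperSet_fourGluePiece q k

/-- The gluing event is increasing. [folklore] -/
theorem isUpperSet_fourGlue (q : ℕ) : IsUpperSet (fourGlue q) :=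
  isUpperSet_iInter₂ fun k _ => isUpperSet_fourGluePiece q k

/-- **The boxes lie in the cone and in the open annulus**: every site `v` of the `k`-th box
(`k < 73`, `q ≥ 1`) satisfies `64q < v₀ < 512Q`, `v₁ < 0 < v₀ + v₁`; in particular
`|v|_𝕋 = v₀`. [cite: Nolin2008, §4.3 Prop. 12 (proof) (arXiv 0711.4948: Prop. 11)] -/
theorem fourGlueBox_subset {q k : ℕ} (hq : 1 ≤ q) (hk : k < 73) {v : Site 2}
    (hv : v ∈ triStrip (fourGlueBox q k).1 (fourGlueBox q k).2.1 (fourGlueBox q k).2.2.1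
      (fourGlueBox q k).2.2.2) :
    (64 * q : ℤ) < v 0 ∧ v 0 < 512 * ((q : ℤ) + 1) ∧ v 1 < 0 ∧ 0 < v 0 + v 1 := by
  have hq' : (1 : ℤ) ≤ q := by exact_mod_cast hq
  unfold fourGlueBox at hv
  split_ifs at hv with h0 h1 h2 h3 h4 h5 h6 h7
  · rw [mem_triStrip] at hv; push_cast at hv
    have hk' : (k : ℤ) ≤ 32 := by exact_mod_cast Nat.lt_succ_iff.1 h0
    have hk0 : (0 : ℤ) ≤ k := by exact_mod_cast Nat.zero_le k
    refine ⟨by omega, by omega, ?_, ?_⟩ <;> nlinarith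
  · rw [mem_triStrip] at hv; push_cast at hv; omega
  · rw [mem_triStrip] at hv; push_cast at hv; omega
  · rw [mem_triStrip] at hv; push_cast at hv; omega
  · rw [mem_triStrip] at hv; push_cast at hv; omega
  · rw [mem_triStrip] at hv; push_cast at hv; omega
  · rw [mem_triStrip] at hv; push_cast at hv; omega
  · rw [mem_triStrip] at hv; push_cast at hv; omega
  · rw [mem_triStrip] at hv; push_cast at hv
    have hk1 : (40 : ℤ) ≤ k := by exact_mod_cast (show 40 ≤ k by omega)
    have hk2 : (k : ℤ) ≤ 72 := by exact_mod_cast (show k ≤ 72 by omega)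
    refine ⟨by omega, by omega, ?_, ?_⟩ <;> nlinarith

/-- The sites of the gluing event lie in `{64q < v₀ = |v|_𝕋 < 512Q} ∩ triCone` (`q ≥ 1`). [cite: Nolin2008, §4.3 Prop. 12 (proof) (arXiv 0711.4948: Prop. 11)] -/
theorem fourGlueFinset_subset {q : ℕ} (hq : 1 ≤ q) {v : Site 2} (hv : v ∈ fourGlueFinset q) :
    (64 * q : ℤ) < v 0 ∧ v 0 < 512 * ((q : ℤ) + 1) ∧ v 1 < 0 ∧ 0 < v 0 + v 1 := by
  simp only [fourGlueFinset, Finset.mem_biUnion, Finset.mem_range] at hv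
  obtain ⟨k, hk, hv⟩ := hv
  have hv' : v ∈ (↑(fourGluePieceFinset q k) : Set (Site 2)) := hv
  rw [fourGluePieceFinset, coe_triStripFinset] at hv'
  exact fourGlueBox_subset hq hk hv'

/-- The sites of the extension event lie in `{64q < v₀ = |v|_𝕋 < 512Q} ∩ triCone` (`q ≥ 1`). [cite: Nolin2008, §4.3 Prop. 12 (proof) (arXiv 0711.4948: Prop. 11)] -/
theorem fourGlueExtFinset_subset {q : ℕ} (hq : 1 ≤ q) {v : Site 2} (hv : v ∈ fourGlueExtFinset q) :
    (64 * q : ℤ) < v 0 ∧ v 0 < 512 * ((q : ℤ) + 1) ∧ v 1 < 0 ∧ 0 < v 0 + v 1 := by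
  simp only [fourGlueExtFinset, Finset.mem_biUnion, Finset.mem_range] at hv
  obtain ⟨k, hk, hv⟩ := hv
  have hv' : v ∈ (↑(fourGluePieceFinset q k) : Set (Site 2)) := hv
  rw [fourGluePieceFinset, coe_triStripFinset] at hv'
  exact fourGlueBox_subset hq (by omega) hv'

/-- **The gluing region**: `{64q < v₀ < 512Q, v₁ < 0 < v₀ + v₁}`, the part of the open cone over
side `0` between the hexagons `∂Λ_{64q}` and `∂Λ_{512Q}`; it contains all gluing boxes. [cite: Nolin2008, §4.3 Prop. 12 (proof) (arXiv 0711.4948: Prop. 11)] -/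
def glueRegion (q : ℕ) : Set (Site 2) :=
  {v | (64 * q : ℤ) < v 0 ∧ v 0 < 512 * ((q : ℤ) + 1) ∧ v 1 < 0 ∧ 0 < v 0 + v 1}

/-- Membership in the gluing region, unfolded. [folklore] -/
@[simp] theorem mem_glueRegion {q : ℕ} {v : Site 2} :
    v ∈ glueRegion q ↔ (64 * q : ℤ) < v 0 ∧ v 0 < 512 * ((q : ℤ) + 1) ∧ v 1 < 0 ∧ 0 < v 0 + v 1 :=
  Iff.rfl

/-- On the gluing region the graph norm is the first coordinate. [folklore] -/
theorem triNorm_eq_of_mem_glueRegion {q : ℕ} {v : Site 2} (hv : v ∈ glueRegion q) : triNorm v = v 0 :=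
  triNorm_eq_apply_zero hv.2.2.1.le hv.2.2.2.le

/-- A box whose left column is beyond `64q`, right column before `512Q`, top row below `0` and
bottom-left corner in the cone lies in the gluing region. [folklore] -/
theorem triStrip_subset_glueRegion {q : ℕ} {a b : ℤ} {m n : ℕ} (ha : (64 * q : ℤ) < a)
    (ham : a + m < 512 * ((q : ℤ) + 1)) (hbn : b + n < 0) (hab : 0 < a + b) :
    triStrip a b m n ⊆ glueRegion q := by
  intro w hw; rw [mem_triStrip] at hw; rw [mem_glueRegion]; omega

/-! ### The pieces, explicitly -/

/-- The thin boxes at scale `64q`. [folklore] -/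
theorem fourGluePiece_lt {q k : ℕ} (hk : k < 33) :
    fourGluePiece q k = triHCross (64 * (q : ℤ) + 1) (((k : ℤ) - 48) * q) (16 * q) q := by
  have hv : ¬ fourGlueVert k := by unfold fourGlueVert; omega
  rw [fourGluePiece, if_neg hv]
  simp only [fourGlueBox, if_pos hk]

/-- Piece `33`. [folklore] -/
theorem fourGluePiece_33 (q : ℕ) :
    fourGluePiece q 33 = triVCross (72 * (q : ℤ)) (-(49 * (q : ℤ))) (8 * q) (35 * q) := by
  have e : fourGlueBox q 33 = (72 * (q : ℤ), -(49 * (q : ℤ)), 8 * q, 35 * q) := by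
    unfold fourGlueBox; rw [if_neg (by norm_num), if_pos rfl]
  rw [fourGluePiece, if_pos (by unfold fourGlueVert; norm_num), e]

/-- Piece `34`. [folklore] -/
theorem fourGluePiece_34 (q : ℕ) :
    fourGluePiece q 34 = triHCross (72 * (q : ℤ)) (-(48 * (q : ℤ))) (64 * q) (16 * q) := by
  have e : fourGlueBox q 34 = (72 * (q : ℤ), -(48 * (q : ℤ)), 64 * q, 16 * q) := by
    unfold fourGlueBox; rw [if_neg (by norm_num), if_neg (by norm_num), if_pos rfl]
  rw [fourGluePiece, if_neg (by unfold fourGlueVert; norm_num), e]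

/-- Piece `35`. [folklore] -/
theorem fourGluePiece_35 (q : ℕ) :
    fourGluePiece q 35 = triVCross (128 * (q : ℤ)) (-(96 * (q : ℤ))) (8 * q) (64 * q) := by
  have e : fourGlueBox q 35 = (128 * (q : ℤ), -(96 * (q : ℤ)), 8 * q, 64 * q) := by
    unfold fourGlueBox; rw [if_neg (by norm_num), if_neg (by norm_num), if_neg (by norm_num), if_pos rfl]
  rw [fourGluePiece, if_pos (by unfold fourGlueVert; norm_num), e]

/-- Piece `36`. [folklore] -/
theorem fourGluePiece_36 (q : ℕ) :
    fourGluePiece q 36 = triHCross (128 * (q : ℤ)) (-(96 * (q : ℤ))) (136 * q) (32 * q) := by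
  have e : fourGlueBox q 36 = (128 * (q : ℤ), -(96 * (q : ℤ)), 136 * q, 32 * q) := by
    unfold fourGlueBox
    rw [if_neg (by norm_num), if_neg (by norm_num), if_neg (by norm_num), if_neg (by norm_num), if_pos rfl]
  rw [fourGluePiece, if_neg (by unfold fourGlueVert; norm_num), e]

/-- Piece `37`. [folklore] -/
theorem fourGluePiece_37 (q : ℕ) :
    fourGluePiece q 37 = triVCross (256 * (q : ℤ)) (-(192 * (q : ℤ))) (8 * q) (128 * q) := by
  have e : fourGlueBox q 37 = (256 * (q : ℤ), -(192 * (q : ℤ)), 8 * q, 128 * q) := by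
    unfold fourGlueBox
    rw [if_neg (by norm_num), if_neg (by norm_num), if_neg (by norm_num), if_neg (by norm_num),
      if_neg (by norm_num), if_pos rfl]
  rw [fourGluePiece, if_pos (by unfold fourGlueVert; norm_num), e]

/-- Piece `38`. [folklore] -/
theorem fourGluePiece_38 (q : ℕ) :
    fourGluePiece q 38 = triHCross (256 * (q : ℤ)) (-(192 * (q : ℤ))) (256 * q + 511) (64 * q) := by
  have e : fourGlueBox q 38 = (256 * (q : ℤ), -(192 * (q : ℤ)), 256 * q + 511, 64 * q) := by
    unfold fourGlueBox
    rw [if_neg (by norm_num), if_neg (by norm_num), if_neg (by norm_num), if_neg (by norm_num),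
      if_neg (by norm_num), if_neg (by norm_num), if_pos rfl]
  rw [fourGluePiece, if_neg (by unfold fourGlueVert; norm_num), e]

/-- Piece `39`. [folklore] -/
theorem fourGluePiece_39 (q : ℕ) :
    fourGluePiece q 39 =
      triVCross (432 * ((q : ℤ) + 1) - 1) (-(392 * ((q : ℤ) + 1) + 1)) (8 * (q + 1)) (392 * (q + 1)) := by
  have e : fourGlueBox q 39 =
      (432 * ((q : ℤ) + 1) - 1, -(392 * ((q : ℤ) + 1) + 1), 8 * (q + 1), 392 * (q + 1)) := by
    unfold fourGlueBox
    rw [if_neg (by norm_num), if_neg (by norm_num), if_neg (by norm_num), if_neg (by norm_num),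
      if_neg (by norm_num), if_neg (by norm_num), if_neg (by norm_num), if_pos rfl]
  rw [fourGluePiece, if_pos (by unfold fourGlueVert; norm_num), e]

/-- The boxes at scale `512Q`. [folklore] -/
theorem fourGluePiece_ge {q k : ℕ} (hk : 40 ≤ k) :
    fourGluePiece q k = triHCross (432 * ((q : ℤ) + 1) - 1) (((k : ℤ) - 88) * (8 * ((q : ℤ) + 1)))
      (80 * (q + 1)) (8 * (q + 1)) := by
  have hv : ¬ fourGlueVert k := by unfold fourGlueVert; omega
  have e : fourGlueBox q k =
      (432 * ((q : ℤ) + 1) - 1, ((k : ℤ) - 88) * (8 * ((q : ℤ) + 1)), 80 * (q + 1), 8 * (q + 1)) := by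
    unfold fourGlueBox
    rw [if_neg (by omega), if_neg (by omega), if_neg (by omega), if_neg (by omega), if_neg (by omega),
      if_neg (by omega), if_neg (by omega), if_neg (by omega)]
  rw [fourGluePiece, if_neg hv, e]

/-! ### The deterministic gluing in the frame of side `0` -/

-- many `linarith` calls on a large context: the default limits are exceeded by a small factor
set_option maxHeartbeats 1600000 in
set_option maxRecDepth 4096 in
/-- **The staircase** (frame of side `0`). A fenced open arm across `Λ_{64q} ∖ Λ_{n₁}` confined to
`X` and the first `39` pieces of the gluing event give an open path, inside
`(X ∩ sepConeSupport n₁ (64q)) ∪ glueRegion q`, from a site `u` of `Λ_{n₁}` to the starting site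
`x` (column `256q`) of the open horizontal crossing of the last box `38`, which ends at a site `y`
of the column `512Q - 1`: the outer free space of the arm is crossed horizontally by one of the
`33` thin boxes (`exists_glueSlab`), which meets the tube `33`, which meets box `34`, …, box `38`
(`PathIn.relay` at each junction). [cite: Nolin2008, §4.3 Prop. 12 (proof) (arXiv 0711.4948: Prop. 11)] -/
theorem sepOpenArmIn_glue_core {q n₁ : ℕ} (hq : 1 ≤ q) (h4 : 4 ≤ n₁) (h₁ : n₁ ≤ 64 * q)
    {X : Set (Site 2)} {ω : SiteConfig (Site 2)} (hA : ω ∈ sepOpenArmIn X n₁ (64 * q))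
    (hG : ∀ k < 39, ω ∈ fourGluePiece q k) :
    ∃ u x y : Site 2, triNorm u ≤ n₁ ∧ x 0 = 256 * (q : ℤ) ∧ y 0 = 512 * ((q : ℤ) + 1) - 1 ∧
      PathIn triGraph ((X ∩ sepConeSupport n₁ (64 * q) ∪ glueRegion q) ∩ ω) u x ∧
      PathIn triGraph (triStrip (256 * (q : ℤ)) (-(192 * (q : ℤ))) (256 * q + 511) (64 * q) ∩ ω) x y := by
  obtain ⟨z, z', u, u', hz, hz', hVin, hVout, hJ⟩ := mem_sepOpenArmIn_inter_support h4 h₁ hA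
  set S := sepConeSupport n₁ (64 * q) with hS
  set T : Set (Site 2) := (X ∩ S ∪ glueRegion q) ∩ ω with hT
  -- integer divisions at the exactly divisible scale
  have e4 : 64 * q / 4 = 16 * q := by omega
  have e8 : 64 * q / 8 = 8 * q := by omega
  have e64 : 64 * q / 64 = q := by omega
  have hq' : (1 : ℤ) ≤ q := by exact_mod_cast hq
  -- the landing row `t = z 1`
  have hzL := hz
  rw [mem_sepLanding, e4] at hzL
  obtain ⟨hz0, hz1, hz2⟩ := hzL
  push_cast at hz0 hz1 hz2
  -- the slab through the outer free space
  obtain ⟨k, hk, hk1, hk2⟩ := exists_glueSlab (s := q) hq (t := z 1) (by linarith) (by linarith)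
  -- the crossings
  have hH : ω ∈ triHCross (64 * (q : ℤ) + 1) (((k : ℤ) - 48) * q) (16 * q) q := by
    rw [← fourGluePiece_lt hk]; exact hG k (by omega)
  have hV : ω ∈ triVCross (72 * (q : ℤ)) (-(49 * (q : ℤ))) (8 * q) (35 * q) := by
    rw [← fourGluePiece_33]; exact hG 33 (by norm_num)
  have hB₀ : ω ∈ triHCross (72 * (q : ℤ)) (-(48 * (q : ℤ))) (64 * q) (16 * q) := by
    rw [← fourGluePiece_34]; exact hG 34 (by norm_num)
  have hV₀ : ω ∈ triVCross (128 * (q : ℤ)) (-(96 * (q : ℤ))) (8 * q) (64 * q) := by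
    rw [← fourGluePiece_35]; exact hG 35 (by norm_num)
  have hB₁ : ω ∈ triHCross (128 * (q : ℤ)) (-(96 * (q : ℤ))) (136 * q) (32 * q) := by
    rw [← fourGluePiece_36]; exact hG 36 (by norm_num)
  have hV₁ : ω ∈ triVCross (256 * (q : ℤ)) (-(192 * (q : ℤ))) (8 * q) (128 * q) := by
    rw [← fourGluePiece_37]; exact hG 37 (by norm_num)
  have hB₂ : ω ∈ triHCross (256 * (q : ℤ)) (-(192 * (q : ℤ))) (256 * q + 511) (64 * q) := by
    rw [← fourGluePiece_38]; exact hG 38 (by norm_num)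
  obtain ⟨xH, yH, hxH, hyH, pH⟩ := hH
  obtain ⟨c, d, hc, hd, pV⟩ := hV
  obtain ⟨x₀, y₀, hx₀, hy₀, pB₀⟩ := hB₀
  obtain ⟨c₀, d₀, hc₀, hd₀, pV₀⟩ := hV₀
  obtain ⟨x₁, y₁, hx₁, hy₁, pB₁⟩ := hB₁
  obtain ⟨c₁, d₁, hc₁, hd₁, pV₁⟩ := hV₁
  obtain ⟨x₂, y₂, hx₂, hy₂, pB₂⟩ := hB₂
  push_cast at hyH hd hy₀ hd₀ hy₁ hd₁ hy₂
  -- the outer fence crossing of the arm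
  rw [e64] at hVout
  obtain ⟨b₁, t₁, hb₁, ht₁, pF₁, pF₁'⟩ := hVout
  have pW : PathIn triGraph (sepOuterFence (64 * q) z ∩ (X ∩ S) ∩ ω) b₁ t₁ := pF₁.trans pF₁'
  have hk' : ((k - 48 : ℤ)) * q = (-48 + (k : ℤ)) * q := by ring
  rw [hk'] at pH
  -- junction 1: the thin box `k` and the outer free space of the arm
  have J₁ := PathIn.relay (L := 64 * (q : ℤ) + 1) (R := 72 * (q : ℤ)) (B := z 1 - q) (T := z 1 + q)
    (by linarith) (by linarith) pH (by rw [hxH]) (by rw [hyH]; linarith)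
    (fun w hw _ _ => by rw [mem_triStrip] at hw; push_cast at hw; constructor <;> linarith)
    pW (by rw [hb₁]) (by rw [ht₁])
    (fun w hw _ _ => by rw [mem_inter_iff, mem_sepOuterFence, e8] at hw; push_cast at hw; constructor <;> linarith)
  -- junction 2: the thin box `k` and the tube `33`
  have J₂ := PathIn.relay (L := 72 * (q : ℤ)) (R := 80 * (q : ℤ)) (B := (-48 + (k : ℤ)) * q)
    (T := (-48 + (k : ℤ)) * q + q) (by linarith) (by linarith) pH (by rw [hxH]; linarith) (by rw [hyH]; linarith)
    (fun w hw _ _ => by rw [mem_triStrip] at hw; push_cast at hw; constructor <;> linarith)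
    pV (by rw [hc]; linarith) (by rw [hd]; linarith)
    (fun w hw _ _ => by rw [mem_triStrip] at hw; push_cast at hw; constructor <;> linarith)
  -- junction 3: box `34` and the tube `33`
  have J₃ := PathIn.relay (L := 72 * (q : ℤ)) (R := 80 * (q : ℤ)) (B := -(48 * (q : ℤ))) (T := -(32 * (q : ℤ)))
    (by linarith) (by linarith) pB₀ (by rw [hx₀]) (by rw [hy₀]; linarith)
    (fun w hw _ _ => by rw [mem_triStrip] at hw; push_cast at hw; constructor <;> linarith)
    pV (by rw [hc]; linarith) (by rw [hd]; linarith)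
    (fun w hw _ _ => by rw [mem_triStrip] at hw; push_cast at hw; constructor <;> linarith)
  -- junction 4: box `34` and the tube `35`
  have J₄ := PathIn.relay (L := 128 * (q : ℤ)) (R := 136 * (q : ℤ)) (B := -(48 * (q : ℤ))) (T := -(32 * (q : ℤ)))
    (by linarith) (by linarith) pB₀ (by rw [hx₀]; linarith) (by rw [hy₀]; linarith)
    (fun w hw _ _ => by rw [mem_triStrip] at hw; push_cast at hw; constructor <;> linarith)
    pV₀ (by rw [hc₀]; linarith) (by rw [hd₀]; linarith)
    (fun w hw _ _ => by rw [mem_triStrip] at hw; push_cast at hw; constructor <;> linarith)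
  -- junction 5: box `36` and the tube `35`
  have J₅ := PathIn.relay (L := 128 * (q : ℤ)) (R := 136 * (q : ℤ)) (B := -(96 * (q : ℤ))) (T := -(64 * (q : ℤ)))
    (by linarith) (by linarith) pB₁ (by rw [hx₁]) (by rw [hy₁]; linarith)
    (fun w hw _ _ => by rw [mem_triStrip] at hw; push_cast at hw; constructor <;> linarith)
    pV₀ (by rw [hc₀]) (by rw [hd₀]; linarith)
    (fun w hw _ _ => by rw [mem_triStrip] at hw; push_cast at hw; constructor <;> linarith)
  -- junction 6: box `36` and the tube `37`
  have J₆ := PathIn.relay (L := 256 * (q : ℤ)) (R := 264 * (q : ℤ)) (B := -(96 * (q : ℤ))) (T := -(64 * (q : ℤ)))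
    (by linarith) (by linarith) pB₁ (by rw [hx₁]; linarith) (by rw [hy₁]; linarith)
    (fun w hw _ _ => by rw [mem_triStrip] at hw; push_cast at hw; constructor <;> linarith)
    pV₁ (by rw [hc₁]; linarith) (by rw [hd₁]; linarith)
    (fun w hw _ _ => by rw [mem_triStrip] at hw; push_cast at hw; constructor <;> linarith)
  -- junction 7: box `38` and the tube `37`
  have J₇ := PathIn.relay (L := 256 * (q : ℤ)) (R := 264 * (q : ℤ)) (B := -(192 * (q : ℤ))) (T := -(128 * (q : ℤ)))
    (by linarith) (by linarith) pB₂ (by rw [hx₂]) (by rw [hy₂]; linarith)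
    (fun w hw _ _ => by rw [mem_triStrip] at hw; push_cast at hw; constructor <;> linarith)
    pV₁ (by rw [hc₁]) (by rw [hd₁]; linarith)
    (fun w hw _ _ => by rw [mem_triStrip] at hw; push_cast at hw; constructor <;> linarith)
  -- the regions
  have gH : triStrip (64 * (q : ℤ) + 1) ((-48 + (k : ℤ)) * q) (16 * q) q ⊆ glueRegion q := by
    exact triStrip_subset_glueRegion (by linarith) (by push_cast; linarith) (by linarith) (by linarith)
  have gV : triStrip (72 * (q : ℤ)) (-(49 * (q : ℤ))) (8 * q) (35 * q) ⊆ glueRegion q :=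
    triStrip_subset_glueRegion (by linarith) (by push_cast; linarith) (by push_cast; linarith) (by linarith)
  have gB₀ : triStrip (72 * (q : ℤ)) (-(48 * (q : ℤ))) (64 * q) (16 * q) ⊆ glueRegion q :=
    triStrip_subset_glueRegion (by linarith) (by push_cast; linarith) (by push_cast; linarith) (by linarith)
  have gV₀ : triStrip (128 * (q : ℤ)) (-(96 * (q : ℤ))) (8 * q) (64 * q) ⊆ glueRegion q :=
    triStrip_subset_glueRegion (by linarith) (by push_cast; linarith) (by push_cast; linarith) (by linarith)
  have gB₁ : triStrip (128 * (q : ℤ)) (-(96 * (q : ℤ))) (136 * q) (32 * q) ⊆ glueRegion q :=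
    triStrip_subset_glueRegion (by linarith) (by push_cast; linarith) (by push_cast; linarith) (by linarith)
  have gV₁ : triStrip (256 * (q : ℤ)) (-(192 * (q : ℤ))) (8 * q) (128 * q) ⊆ glueRegion q :=
    triStrip_subset_glueRegion (by linarith) (by push_cast; linarith) (by push_cast; linarith) (by linarith)
  have gB₂ : triStrip (256 * (q : ℤ)) (-(192 * (q : ℤ))) (256 * q + 511) (64 * q) ⊆ glueRegion q :=
    triStrip_subset_glueRegion (by linarith) (by push_cast; linarith) (by push_cast; linarith) (by linarith)
  have mXS : ∀ F : Set (Site 2), F ∩ (X ∩ S) ∩ ω ⊆ T := fun F v hv => ⟨Or.inl hv.1.2, hv.2⟩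
  have mG : ∀ {F : Set (Site 2)}, F ⊆ glueRegion q → F ∩ ω ⊆ T := fun hF v hv => ⟨Or.inr (hF hv.1), hv.2⟩
  have mG2 : ∀ {F F' : Set (Site 2)}, F ⊆ glueRegion q → F' ⊆ glueRegion q → (F ∪ F') ∩ ω ⊆ T := by
    intro F F' hF hF' v hv
    rcases hv.1 with h | h
    · exact ⟨Or.inr (hF h), hv.2⟩
    · exact ⟨Or.inr (hF' h), hv.2⟩
  have m₁ : (triStrip (64 * (q : ℤ) + 1) ((-48 + (k : ℤ)) * q) (16 * q) q ∪
      sepOuterFence (64 * q) z ∩ (X ∩ S)) ∩ ω ⊆ T := by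
    intro v hv
    rcases hv.1 with h | h
    · exact ⟨Or.inr (gH h), hv.2⟩
    · exact ⟨Or.inl h.2, hv.2⟩
  -- the open path from the inner free space of the arm to the start of the crossing of box `38`
  have P : PathIn triGraph T u x₂ :=
    (hJ.mono (mXS _)) |>.trans (pF₁.symm.mono (mXS _)) |>.trans (J₁.symm.mono m₁)
      |>.trans (J₂.mono (mG2 gH gV)) |>.trans (J₃.symm.mono (mG2 gB₀ gV)) |>.trans (J₄.mono (mG2 gB₀ gV₀))
      |>.trans (J₅.symm.mono (mG2 gB₁ gV₀)) |>.trans (J₆.mono (mG2 gB₁ gV₁)) |>.trans (J₇.symm.mono (mG2 gB₂ gV₁))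
  obtain ⟨b₀, t₀, -, -, pF₀, -⟩ := hVin
  exact ⟨u, x₂, y₂, triNorm_le_of_mem_sepInnerFence hz' pF₀.right_mem.1.1, hx₂, by rw [hy₂]; ring, P, pB₂⟩

/-- **Extension (frame of side `0`).** A fenced open arm across `Λ_{64q} ∖ Λ_{n₁}` confined to
`X` and the extension event `fourGlueExt q` give an open path inside
`(X ∩ sepConeSupport n₁ (64q)) ∪ glueRegion q` from a site of `Λ_{n₁}` to a site of graph norm
`512Q - 1` (Nolin 2008, Prop. 12 (i): "once well-separated, the arms can easily be extended"). [cite: Nolin2008, §4.3 Prop. 12 (proof) (arXiv 0711.4948: Prop. 11)] -/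
theorem sepOpenArmIn_glueExt_path {q n₁ : ℕ} (hq : 1 ≤ q) (h4 : 4 ≤ n₁) (h₁ : n₁ ≤ 64 * q)
    {X : Set (Site 2)} {ω : SiteConfig (Site 2)} (hA : ω ∈ sepOpenArmIn X n₁ (64 * q))
    (hG : ω ∈ fourGlueExt q) :
    ∃ u y : Site 2, triNorm u ≤ n₁ ∧ triNorm y = 512 * ((q : ℤ) + 1) - 1 ∧
      PathIn triGraph ((X ∩ sepConeSupport n₁ (64 * q) ∪ glueRegion q) ∩ ω) u y := by
  have hG' : ∀ k < 39, ω ∈ fourGluePiece q k := by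
    intro k hk
    simp only [fourGlueExt, mem_iInter, Finset.mem_range] at hG
    exact hG k hk
  obtain ⟨u, x, y, hu, -, hy, P, pB⟩ := sepOpenArmIn_glue_core hq h4 h₁ hA hG'
  have hq' : (1 : ℤ) ≤ q := by exact_mod_cast hq
  have gB : triStrip (256 * (q : ℤ)) (-(192 * (q : ℤ))) (256 * q + 511) (64 * q) ⊆ glueRegion q :=
    triStrip_subset_glueRegion (by linarith) (by push_cast; linarith) (by push_cast; linarith) (by linarith)
  have hyR : y ∈ glueRegion q := gB pB.right_mem.1
  refine ⟨u, y, hu, by rw [triNorm_eq_of_mem_glueRegion hyR, hy], P.trans (pB.mono ?_)⟩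
  exact fun v hv => ⟨Or.inr (gB hv.1), hv.2⟩

-- many `linarith` calls on a large context
set_option maxHeartbeats 1600000 in
set_option maxRecDepth 4096 in
/-- **Gluing (one open arm, frame of side `0`).** A fenced open arm across `Λ_{64q} ∖ Λ_{n₁}`
confined to `X`, the gluing event `fourGlue q` and a fenced open arm across `Λ_{n₃} ∖ Λ_{512Q}`
confined to `X'` give an open path inside
`(X ∩ sepConeSupport n₁ (64q)) ∪ glueRegion q ∪ (X' ∩ sepConeSupport (512Q) n₃)` from a site of
`Λ_{n₁}` to a site outside `Λ_{n₃}`: the staircase (`sepOpenArmIn_glue_core`) is continued through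
the tube `39` and one of the `33` boxes at scale `512Q`, which crosses the inner free space of the
second arm (Nolin 2008, proof of Prop. 12 (ii) [arXiv Prop. 11]; Kesten 1987, fences). [cite: Nolin2008, §4.3 Prop. 12 (proof) (arXiv 0711.4948: Prop. 11)] -/
theorem sepOpenArmIn_glue_path {q n₁ n₃ : ℕ} (hq : 1 ≤ q) (h4 : 4 ≤ n₁) (h₁ : n₁ ≤ 64 * q)
    (h₃ : 512 * (q + 1) ≤ n₃) {X X' : Set (Site 2)} {ω : SiteConfig (Site 2)}
    (hA : ω ∈ sepOpenArmIn X n₁ (64 * q)) (hG : ω ∈ fourGlue q)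
    (hA' : ω ∈ sepOpenArmIn X' (512 * (q + 1)) n₃) :
    ∃ u u' : Site 2, triNorm u ≤ n₁ ∧ (n₃ : ℤ) < triNorm u' ∧
      PathIn triGraph ((X ∩ sepConeSupport n₁ (64 * q) ∪ glueRegion q ∪
        X' ∩ sepConeSupport (512 * (q + 1)) n₃) ∩ ω) u u' := by
  have hGk : ∀ k < 73, ω ∈ fourGluePiece q k := by
    intro k hk
    simp only [fourGlue, mem_iInter, Finset.mem_range] at hG
    exact hG k hk
  obtain ⟨u, x₂, y₂, hu, hx₂, hy₂, P, pB₂⟩ :=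
    sepOpenArmIn_glue_core hq h4 h₁ hA (fun k hk => hGk k (by omega))
  obtain ⟨Z, Z', U, U', hZ, hZ', hVin₂, hVout₂, hJ₂⟩ :=
    mem_sepOpenArmIn_inter_support (by omega) h₃ hA'
  set S := sepConeSupport n₁ (64 * q) with hS
  set S' := sepConeSupport (512 * (q + 1)) n₃ with hS'
  set T : Set (Site 2) := (X ∩ S ∪ glueRegion q ∪ X' ∩ S') ∩ ω with hT
  have E4 : 512 * (q + 1) / 4 = 128 * (q + 1) := by omega
  have E8 : 512 * (q + 1) / 8 = 64 * (q + 1) := by omega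
  have E64 : 512 * (q + 1) / 64 = 8 * (q + 1) := by omega
  have hq' : (1 : ℤ) ≤ q := by exact_mod_cast hq
  -- the landing row `t' = Z' 1`
  have hZL := hZ'
  rw [mem_sepLanding, E4] at hZL
  obtain ⟨hZ0, hZ1, hZ2⟩ := hZL
  push_cast at hZ0 hZ1 hZ2
  obtain ⟨k', hk', hk1', hk2'⟩ := exists_glueSlab (s := 8 * (q + 1)) (by omega) (t := Z' 1)
    (by push_cast; linarith) (by push_cast; linarith)
  push_cast at hk1' hk2'
  -- the crossings
  have hV' : ω ∈ triVCross (432 * ((q : ℤ) + 1) - 1) (-(392 * ((q : ℤ) + 1) + 1)) (8 * (q + 1)) (392 * (q + 1)) := by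
    rw [← fourGluePiece_39]; exact hGk 39 (by norm_num)
  have hH' : ω ∈ triHCross (432 * ((q : ℤ) + 1) - 1) ((-48 + (k' : ℤ)) * (8 * ((q : ℤ) + 1)))
      (80 * (q + 1)) (8 * (q + 1)) := by
    have h := hGk (40 + k') (by omega)
    rw [fourGluePiece_ge (by omega)] at h
    have e : (((40 + k' : ℕ) : ℤ) - 88) * (8 * ((q : ℤ) + 1)) = (-48 + (k' : ℤ)) * (8 * ((q : ℤ) + 1)) := by
      push_cast; ring
    rwa [e] at h
  obtain ⟨c', d', hc', hd', pV'⟩ := hV'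
  obtain ⟨xH, yH, hxH, hyH, pH'⟩ := hH'
  push_cast at hd' hyH
  -- the inner fence crossing of the second arm
  rw [E64] at hVin₂
  obtain ⟨b₂, t₂, hb₂, ht₂, pF₂, pF₂'⟩ := hVin₂
  have pW₂ : PathIn triGraph (sepInnerFence (512 * (q + 1)) Z' ∩ (X' ∩ S') ∩ ω) b₂ t₂ := pF₂.trans pF₂'
  push_cast at hb₂ ht₂
  -- junction 8: box `38` and the tube `39`
  have J₈ := PathIn.relay (L := 432 * ((q : ℤ) + 1) - 1) (R := 440 * ((q : ℤ) + 1) - 1)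
    (B := -(192 * (q : ℤ))) (T := -(128 * (q : ℤ))) (by linarith) (by linarith) pB₂ (by rw [hx₂]; linarith)
    (by rw [hy₂]; linarith)
    (fun w hw _ _ => by rw [mem_triStrip] at hw; push_cast at hw; constructor <;> linarith)
    pV' (by rw [hc']; linarith) (by rw [hd']; linarith)
    (fun w hw _ _ => by rw [mem_triStrip] at hw; push_cast at hw; constructor <;> linarith)
  -- junction 9: the box `k'` at scale `512Q` and the tube `39`
  have J₉ := PathIn.relay (L := 432 * ((q : ℤ) + 1) - 1) (R := 440 * ((q : ℤ) + 1) - 1)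
    (B := (-48 + (k' : ℤ)) * (8 * ((q : ℤ) + 1))) (T := (-48 + (k' : ℤ)) * (8 * ((q : ℤ) + 1)) + 8 * ((q : ℤ) + 1))
    (by linarith) (by linarith) pH' (by rw [hxH]) (by rw [hyH]; linarith)
    (fun w hw _ _ => by rw [mem_triStrip] at hw; push_cast at hw; constructor <;> linarith)
    pV' (by rw [hc']; linarith) (by rw [hd']; linarith)
    (fun w hw _ _ => by rw [mem_triStrip] at hw; push_cast at hw; constructor <;> linarith)
  -- junction 10: the box `k'` and the inner free space of the second arm
  have J₁₀ := PathIn.relay (L := 448 * ((q : ℤ) + 1)) (R := 512 * ((q : ℤ) + 1) - 1)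
    (B := Z' 1 - 8 * ((q : ℤ) + 1)) (T := Z' 1 + 8 * ((q : ℤ) + 1)) (by linarith) (by linarith) pH'
    (by rw [hxH]; linarith) (by rw [hyH]; linarith)
    (fun w hw _ _ => by rw [mem_triStrip] at hw; push_cast at hw; constructor <;> linarith)
    pW₂ (by rw [hb₂]) (by rw [ht₂])
    (fun w hw _ _ => by
      rw [mem_inter_iff, mem_sepInnerFence, E8] at hw; push_cast at hw; constructor <;> linarith)
  -- the regions
  have gB₂ : triStrip (256 * (q : ℤ)) (-(192 * (q : ℤ))) (256 * q + 511) (64 * q) ⊆ glueRegion q :=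
    triStrip_subset_glueRegion (by linarith) (by push_cast; linarith) (by push_cast; linarith) (by linarith)
  have gV' : triStrip (432 * ((q : ℤ) + 1) - 1) (-(392 * ((q : ℤ) + 1) + 1)) (8 * (q + 1)) (392 * (q + 1)) ⊆
      glueRegion q :=
    triStrip_subset_glueRegion (by linarith) (by push_cast; linarith) (by push_cast; linarith) (by linarith)
  have gH' : triStrip (432 * ((q : ℤ) + 1) - 1) ((-48 + (k' : ℤ)) * (8 * ((q : ℤ) + 1))) (80 * (q + 1))
      (8 * (q + 1)) ⊆ glueRegion q :=
    triStrip_subset_glueRegion (by linarith) (by push_cast; linarith) (by push_cast; linarith) (by linarith)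
  have mG2 : ∀ {F F' : Set (Site 2)}, F ⊆ glueRegion q → F' ⊆ glueRegion q → (F ∪ F') ∩ ω ⊆ T := by
    intro F F' hF hF' v hv
    rcases hv.1 with h | h
    · exact ⟨Or.inl (Or.inr (hF h)), hv.2⟩
    · exact ⟨Or.inl (Or.inr (hF' h)), hv.2⟩
  have m₁₀ : (triStrip (432 * ((q : ℤ) + 1) - 1) ((-48 + (k' : ℤ)) * (8 * ((q : ℤ) + 1))) (80 * (q + 1)) (8 * (q + 1)) ∪
      sepInnerFence (512 * (q + 1)) Z' ∩ (X' ∩ S')) ∩ ω ⊆ T := by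
    intro v hv
    rcases hv.1 with h | h
    · exact ⟨Or.inl (Or.inr (gH' h)), hv.2⟩
    · exact ⟨Or.inr h.2, hv.2⟩
  have mXS' : ∀ F : Set (Site 2), F ∩ (X' ∩ S') ∩ ω ⊆ T := fun F v hv => ⟨Or.inr hv.1.2, hv.2⟩
  have mT : (X ∩ S ∪ glueRegion q) ∩ ω ⊆ T := fun v hv => ⟨Or.inl hv.1, hv.2⟩
  have P' : PathIn triGraph T u U' :=
    (P.mono mT) |>.trans (J₈.mono (mG2 gB₂ gV')) |>.trans (J₉.symm.mono (mG2 gH' gV')) |>.trans (J₁₀.mono m₁₀)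
      |>.trans (pF₂.mono (mXS' _)) |>.trans (hJ₂.mono (mXS' _))
  obtain ⟨B₀, T₀, -, -, pG₀, -⟩ := hVout₂
  exact ⟨u, U', hu, lt_triNorm_of_mem_sepOuterFence pG₀.right_mem.1.1, P'⟩

/-! ### The zones of the four glued arms and their disjointness -/

/-- **The zone of a glued arm landing on side `i`**: the sites the arm with inner confining set `X`
(scale `(n₁, 64q)`) and outer confining set `X'` (scale `(512Q, n₃)`) may use after gluing —
`X ∩ ρ^i(sepConeSupport n₁ (64q))`, the rotated gluing region `ρ^i(glueRegion q)` and
`X' ∩ ρ^i(sepConeSupport (512Q) n₃)`. [cite: Nolin2008, §4.3 Prop. 12 (proof) (arXiv 0711.4948: Prop. 11)] -/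
def glueZone (q n₁ n₃ i : ℕ) (X X' : Set (Site 2)) : Set (Site 2) :=
  X ∩ triRotIsoPow i '' sepConeSupport n₁ (64 * q) ∪ triRotIsoPow i '' glueRegion q ∪
    X' ∩ triRotIsoPow i '' sepConeSupport (512 * (q + 1)) n₃

/-- The zone is the `ρ^i`-image of the region of the frame-`0` gluing lemma. [folklore] -/
theorem image_rot_eq_glueZone (q n₁ n₃ i : ℕ) (X X' : Set (Site 2)) :
    triRotIsoPow i '' ((triRotIsoPow i) ⁻¹' X ∩ sepConeSupport n₁ (64 * q) ∪ glueRegion q ∪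
      (triRotIsoPow i) ⁻¹' X' ∩ sepConeSupport (512 * (q + 1)) n₃) = glueZone q n₁ n₃ i X X' := by
  rw [image_union, image_union, image_preimage_inter, image_preimage_inter]
  rfl

/-- A site of the gluing region lies in the open cone, beyond `∂Λ_{64q}` and before `∂Λ_{512Q}`. [folklore] -/
theorem mem_triCone_of_mem_glueRegion {q : ℕ} {v : Site 2} (hv : v ∈ glueRegion q) :
    (0 < v 0 ∧ v 1 < 0 ∧ 0 < v 0 + v 1) ∧ (64 * q : ℤ) < triNorm v ∧ triNorm v < 512 * ((q : ℤ) + 1) := by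
  rw [triNorm_eq_of_mem_glueRegion hv]
  rw [mem_glueRegion] at hv
  exact ⟨⟨by omega, hv.2.2.1, hv.2.2.2⟩, hv.1, hv.2.1⟩

/-- **The zones of arms landing on different sides are disjoint** (`q ≥ 1`, `i ≠ j < 6`), provided
the inner confining sets and the outer confining sets are: off the closed annuli the supports lie
in the open cones over the respective sides, which are disjoint (`rot_sector_injective`), the
gluing regions lie in these cones strictly between the two annuli, and the inner supports
(`|·|_𝕋 ≤ 72q`) do not reach the outer ones (`|·|_𝕋 ≥ 448Q`). [cite: Nolin2008, §4.3 Prop. 12 (proof) (arXiv 0711.4948: Prop. 11)] -/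
theorem glueZone_disjoint {q n₁ n₃ i j : ℕ} (hq : 1 ≤ q) (hi : i < 6) (hj : j < 6) (hij : i ≠ j)
    {Xi Xj Xi' Xj' : Set (Site 2)} (hX : Disjoint Xi Xj) (hX' : Disjoint Xi' Xj') :
    Disjoint (glueZone q n₁ n₃ i Xi Xi') (glueZone q n₁ n₃ j Xj Xj') := by
  have e8 : 64 * q / 8 = 8 * q := by omega
  have E8 : 512 * (q + 1) / 8 = 64 * (q + 1) := by omega
  -- the three kinds of sites of a zone
  have kA : ∀ {a : ℕ} {X X' : Set (Site 2)} {w : Site 2}, w ∈ X ∩ triRotIsoPow a '' sepConeSupport n₁ (64 * q) →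
      w ∈ X ∧ triNorm w ≤ 72 * (q : ℤ) ∧ ∃ v : Site 2, triRotIsoPow a v = w ∧
        ((64 * q : ℤ) < triNorm w → (0 < v 0 ∧ v 1 < 0 ∧ 0 < v 0 + v 1)) := by
    rintro a X X' w ⟨hwX, v, hv, hvw⟩
    rw [mem_sepConeSupport, e8] at hv
    have hn : triNorm w = triNorm v := by rw [← hvw, triNorm_rot]
    push_cast at hv
    refine ⟨hwX, by rw [hn]; linarith [hv.2.1], v, hvw, fun hlt => hv.2.2 (Or.inr ?_)⟩
    rw [hn] at hlt; exact_mod_cast hlt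
  have kG : ∀ {a : ℕ} {w : Site 2}, w ∈ triRotIsoPow a '' glueRegion q →
      (64 * q : ℤ) < triNorm w ∧ triNorm w < 512 * ((q : ℤ) + 1) ∧
        ∃ v : Site 2, triRotIsoPow a v = w ∧ (0 < v 0 ∧ v 1 < 0 ∧ 0 < v 0 + v 1) := by
    rintro a w ⟨v, hv, hvw⟩
    obtain ⟨hc, h1, h2⟩ := mem_triCone_of_mem_glueRegion hv
    have hn : triNorm w = triNorm v := by rw [← hvw, triNorm_rot]
    exact ⟨by rw [hn]; exact h1, by rw [hn]; exact h2, v, hvw, hc⟩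
  have kB : ∀ {a : ℕ} {X X' : Set (Site 2)} {w : Site 2},
      w ∈ X' ∩ triRotIsoPow a '' sepConeSupport (512 * (q + 1)) n₃ →
      w ∈ X' ∧ (448 * ((q : ℤ) + 1)) ≤ triNorm w ∧ ∃ v : Site 2, triRotIsoPow a v = w ∧
        (triNorm w < 512 * ((q : ℤ) + 1) → (0 < v 0 ∧ v 1 < 0 ∧ 0 < v 0 + v 1)) := by
    rintro a X X' w ⟨hwX, v, hv, hvw⟩
    rw [mem_sepConeSupport, E8] at hv
    have hn : triNorm w = triNorm v := by rw [← hvw, triNorm_rot]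
    push_cast at hv
    refine ⟨hwX, by rw [hn]; linarith [hv.1], v, hvw, fun hlt => hv.2.2 (Or.inl ?_)⟩
    rw [hn] at hlt; exact_mod_cast hlt
  have hq' : (1 : ℤ) ≤ q := by exact_mod_cast hq
  rw [Set.disjoint_left]
  rintro w ((hwi | hwi) | hwi) ((hwj | hwj) | hwj)
  · exact Set.disjoint_left.1 hX (kA (X' := Xi') hwi).1 (kA (X' := Xj') hwj).1
  · obtain ⟨-, -, v, hvw, hv⟩ := kA (X' := Xi') hwi
    obtain ⟨h1, -, v', hv'w, hv'⟩ := kG hwj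
    exact hij (rot_sector_injective hi hj (hv h1) hv' (hvw.trans hv'w.symm))
  · obtain ⟨-, h1, -⟩ := kA (X' := Xi') hwi
    obtain ⟨-, h2, -⟩ := kB (X := Xj) hwj
    linarith
  · obtain ⟨h1, -, v, hvw, hv⟩ := kG hwi
    obtain ⟨-, -, v', hv'w, hv'⟩ := kA (X' := Xj') hwj
    exact hij (rot_sector_injective hi hj hv (hv' h1) (hvw.trans hv'w.symm))
  · obtain ⟨-, -, v, hvw, hv⟩ := kG hwi
    obtain ⟨-, -, v', hv'w, hv'⟩ := kG hwj
    exact hij (rot_sector_injective hi hj hv hv' (hvw.trans hv'w.symm))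
  · obtain ⟨-, h2, v, hvw, hv⟩ := kG hwi
    obtain ⟨-, -, v', hv'w, hv'⟩ := kB (X := Xj) hwj
    exact hij (rot_sector_injective hi hj hv (hv' h2) (hvw.trans hv'w.symm))
  · obtain ⟨-, h1, -⟩ := kB (X := Xi) hwi
    obtain ⟨-, h2, -⟩ := kA (X' := Xj') hwj
    linarith
  · obtain ⟨-, -, v, hvw, hv⟩ := kB (X := Xi) hwi
    obtain ⟨-, h2, v', hv'w, hv'⟩ := kG hwj
    exact hij (rot_sector_injective hi hj (hv h2) hv' (hvw.trans hv'w.symm))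
  · exact Set.disjoint_left.1 hX' (kB (X := Xi) hwi).1 (kB (X := Xj) hwj).1

/-- Sets of sites of different colours are disjoint. [folklore] -/
theorem disjoint_inter_colour {A B : Set (Site 2)} {ω : SiteConfig (Site 2)} {b b' : Bool} (h : b ≠ b') :
    Disjoint (A ∩ {v | v ∈ ω ↔ b}) (B ∩ {v | v ∈ ω ↔ b'}) := by
  rw [Set.disjoint_left]
  rintro v ⟨-, hv⟩ ⟨-, hv'⟩
  simp only [mem_setOf_eq] at hv hv'
  cases b <;> cases b' <;> simp_all

/-! ### Glued arms in the original frame -/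

/-- **Gluing one arm of colour `b` landing on side `i`.** From a fenced arm of colour `b` landing on
side `i` across `Λ_{64q} ∖ Λ_{n₁}` confined to `X`, the gluing event read in colour `b` in frame
`i`, and a fenced arm of colour `b` landing on side `i` across `Λ_{n₃} ∖ Λ_{512Q}` confined to
`X'`, an arm of colour `b` of the annulus `{n₁ ≤ |·|_𝕋 ≤ n₃}` inside the zone
`glueZone q n₁ n₃ i X X'` (`sepOpenArmIn_glue_path` in frame `i`, carried back by `ρ^i`, trimmed by
`PathIn.exists_arm_of_triNorm_le`). [cite: Nolin2008, §4.3 Prop. 12 (proof) (arXiv 0711.4948: Prop. 11)] -/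
theorem sepArmAt_glue_path {q n₁ n₃ i : ℕ} {b : Bool} (hq : 1 ≤ q) (h4 : 4 ≤ n₁) (h₁ : n₁ ≤ 64 * q)
    (h₃ : 512 * (q + 1) ≤ n₃) {X X' : Set (Site 2)} {ω : SiteConfig (Site 2)}
    (hA : ω ∈ sepArmAt i b X n₁ (64 * q)) (hG : readFrame i b ω ∈ fourGlue q)
    (hA' : ω ∈ sepArmAt i b X' (512 * (q + 1)) n₃) :
    ∃ x y : Site 2, triNorm x = n₁ ∧ triNorm y = n₃ ∧
      PathIn triGraph (glueZone q n₁ n₃ i X X' ∩ triAnnSet n₁ n₃ ∩ {v | v ∈ ω ↔ b}) x y := by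
  obtain ⟨u, u', hu, hu', P⟩ := sepOpenArmIn_glue_path hq h4 h₁ h₃ hA hG hA'
  have P' := pathIn_of_rotConfig_colour i b P
  rw [image_rot_eq_glueZone] at P'
  have h13 : n₁ ≤ n₃ := h₁.trans (le_trans (by omega) h₃)
  obtain ⟨x, y, hx, hy, Q⟩ := P'.exists_arm_of_triNorm_le (r := n₁) (R := n₃)
    (by rw [triNorm_rot]; exact hu) (by rw [triNorm_rot]; exact hu'.le) h13
  refine ⟨x, y, hx, hy, Q.mono ?_⟩
  rintro v ⟨hv, hvZ, hvc⟩
  exact ⟨⟨hvZ, hv⟩, hvc⟩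

/-- **Extending one arm of colour `b` landing on side `i`** to graph norm `512Q - 1`, inside the zone
`glueZone q n₁ n₃ i X ∅`. [cite: Nolin2008, §4.3 Prop. 12 (proof) (arXiv 0711.4948: Prop. 11)] -/
theorem sepArmAt_glueExt_path {q n₁ i : ℕ} (n₃ : ℕ) {b : Bool} (hq : 1 ≤ q) (h4 : 4 ≤ n₁)
    (h₁ : n₁ ≤ 64 * q) {X : Set (Site 2)} {ω : SiteConfig (Site 2)}
    (hA : ω ∈ sepArmAt i b X n₁ (64 * q)) (hG : readFrame i b ω ∈ fourGlueExt q) :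
    ∃ x y : Site 2, triNorm x = n₁ ∧ triNorm y = (512 * (q + 1) - 1 : ℕ) ∧
      PathIn triGraph (glueZone q n₁ n₃ i X ∅ ∩ triAnnSet n₁ (512 * (q + 1) - 1) ∩ {v | v ∈ ω ↔ b}) x y := by
  obtain ⟨u, u', hu, hu', P⟩ := sepOpenArmIn_glueExt_path hq h4 h₁ hA hG
  have P' := pathIn_of_rotConfig_colour i b P
  rw [image_union, image_preimage_inter] at P'
  have h13 : n₁ ≤ 512 * (q + 1) - 1 := by omega
  have hc : ((512 * (q + 1) - 1 : ℕ) : ℤ) = 512 * ((q : ℤ) + 1) - 1 := by push_cast [Nat.cast_sub (by omega : 1 ≤ 512 * (q + 1))]; ring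
  obtain ⟨x, y, hx, hy, Q⟩ := P'.exists_arm_of_triNorm_le (r := n₁) (R := 512 * (q + 1) - 1)
    (by rw [triNorm_rot]; exact hu) (by rw [triNorm_rot, hu', hc]) h13
  refine ⟨x, y, hx, hy, Q.mono ?_⟩
  rintro v ⟨hv, hvZ, hvc⟩
  refine ⟨⟨?_, hv⟩, hvc⟩
  rcases hvZ with h | h
  · exact Or.inl (Or.inl h)
  · exact Or.inl (Or.inr h)

/-! ### Arms in pairwise disjoint zones form an arm event -/

/-- **Arms in pairwise disjoint sets of sites are vertex-disjoint arms.** If for every `j < k` the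
configuration `ω` has a `𝕋`-path of colour `κ j` inside `Z j ∩ {n ≤ |·|_𝕋 ≤ N}` from a site of norm
`n` to a site of norm `N`, and the sets `Z j` are pairwise disjoint, then `ω ∈ armEvent κ n N`
(the self-avoiding sub-walks `Walk.toPath` stay in the `Z j`). Generalises
`mem_armEvent_of_sectorPaths` (fixed rotated sectors) to configuration-dependent zones. [cite: Nolin2008, §4.1 and Prop. 12 (arXiv 0711.4948: Prop. 11)] -/
theorem mem_armEvent_of_disjointPaths {k : ℕ} (κ : Fin k → Bool) {n N : ℕ} {ω : SiteConfig (Site 2)}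
    (Z : Fin k → Set (Site 2)) (hZ : ∀ i j, i ≠ j → Disjoint (Z i) (Z j))
    (h : ∀ j : Fin k, ∃ x y : Site 2, triNorm x = n ∧ triNorm y = N ∧
      PathIn triGraph (Z j ∩ triAnnSet n N ∩ {v | v ∈ ω ↔ κ j}) x y) :
    ω ∈ armEvent κ n N := by
  classical
  choose x y hx hy hp using h
  have hW : ∀ j, ∃ W : triGraph.Walk (x j) (y j), ∀ v ∈ W.support,
      v ∈ Z j ∩ triAnnSet n N ∩ {v | v ∈ ω ↔ κ j} := fun j => (hp j).exists_walk
  choose W hWs using hW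
  refine ⟨x, y, fun j => (W j).toPath, fun j => ⟨?_, ?_, (W j).toPath.2, fun v hv => ?_, fun v hv => ?_⟩, ?_⟩
  · exact mem_triSphere_iff.2 (hx j)
  · exact mem_triSphere_iff.2 (hy j)
  · have hv' := (hWs j v (SimpleGraph.Walk.support_toPath_subset_support (W j) hv)).1.2
    rw [mem_triAnnSet] at hv'
    rcases eq_or_lt_of_le hv'.1 with h1 | h1
    · right; rw [mem_triSphere_iff, ← h1]
    · left
      simp only [Set.mem_sdiff, Finset.mem_coe, mem_triBall_iff, not_le]
      exact ⟨hv'.2, h1⟩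
  · exact (hWs j v (SimpleGraph.Walk.support_toPath_subset_support (W j) hv)).2
  · intro i j hij
    rw [Finset.disjoint_left]
    intro v hvi hvj
    rw [List.mem_toFinset] at hvi hvj
    have hi := (hWs i v (SimpleGraph.Walk.support_toPath_subset_support (W i) hvi)).1.1
    have hj := (hWs j v (SimpleGraph.Walk.support_toPath_subset_support (W j) hvj)).1.1
    exact Set.disjoint_left.1 (hZ i j hij) hi hj

/-- The four-arm instance with the zones and colours listed explicitly. [cite: Nolin2008, §4.1 and Prop. 12 (arXiv 0711.4948: Prop. 11)] -/
theorem mem_armEvent_four_of_disjointPaths {n N : ℕ} {ω : SiteConfig (Site 2)} {Z₀ Z₁ Z₂ Z₃ : Set (Site 2)}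
    (h01 : Disjoint Z₀ Z₁) (h02 : Disjoint Z₀ Z₂) (h03 : Disjoint Z₀ Z₃) (h12 : Disjoint Z₁ Z₂)
    (h13 : Disjoint Z₁ Z₃) (h23 : Disjoint Z₂ Z₃)
    (p₀ : ∃ x y : Site 2, triNorm x = n ∧ triNorm y = N ∧ PathIn triGraph (Z₀ ∩ triAnnSet n N ∩ {v | v ∈ ω ↔ true}) x y)
    (p₁ : ∃ x y : Site 2, triNorm x = n ∧ triNorm y = N ∧ PathIn triGraph (Z₁ ∩ triAnnSet n N ∩ {v | v ∈ ω ↔ false}) x y)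
    (p₂ : ∃ x y : Site 2, triNorm x = n ∧ triNorm y = N ∧ PathIn triGraph (Z₂ ∩ triAnnSet n N ∩ {v | v ∈ ω ↔ true}) x y)
    (p₃ : ∃ x y : Site 2, triNorm x = n ∧ triNorm y = N ∧ PathIn triGraph (Z₃ ∩ triAnnSet n N ∩ {v | v ∈ ω ↔ false}) x y) :
    ω ∈ armEvent ![true, false, true, false] n N := by
  refine mem_armEvent_of_disjointPaths _ ![Z₀, Z₁, Z₂, Z₃] ?_ ?_
  · intro i j hij
    fin_cases i <;> fin_cases j
    all_goals first
      | exact absurd rfl hij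
      | exact h01 | exact h01.symm | exact h02 | exact h02.symm | exact h03 | exact h03.symm
      | exact h12 | exact h12.symm | exact h13 | exact h13.symm | exact h23 | exact h23.symm
  · intro j
    fin_cases j
    · exact p₀
    · exact p₁
    · exact p₂
    · exact p₃

/-! ### The gluing events in the four frames and the two deterministic gluing theorems -/

/-- **The four rotated gluing events**: the gluing event read in colour `true` in the frames of
sides `0` and `3` (open tubes) and in colour `false` in the frames of sides `1` and `4` (closed
tubes), grouped as (increasing part) ∩ (decreasing part). [cite: Nolin2008, §4.3 Prop. 12 (proof) (arXiv 0711.4948: Prop. 11)] -/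
def fourGlueFrames (q : ℕ) : Set (SiteConfig (Site 2)) :=
  (readFrame 0 true ⁻¹' fourGlue q ∩ readFrame 3 true ⁻¹' fourGlue q) ∩
    (readFrame 1 false ⁻¹' fourGlue q ∩ readFrame 4 false ⁻¹' fourGlue q)

/-- **The four rotated extension events**, grouped likewise. [cite: Nolin2008, §4.3 Prop. 12 (proof) (arXiv 0711.4948: Prop. 11)] -/
def fourGlueExtFrames (q : ℕ) : Set (SiteConfig (Site 2)) :=
  (readFrame 0 true ⁻¹' fourGlueExt q ∩ readFrame 3 true ⁻¹' fourGlueExt q) ∩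
    (readFrame 1 false ⁻¹' fourGlueExt q ∩ readFrame 4 false ⁻¹' fourGlueExt q)

/-- **Gluing four arms** (Nolin 2008, proof of Prop. 12 (ii) [arXiv 0711.4948: Prop. 11],
`j = 4`, alternating colours, at the scales `64q ≤ 512(q+1)`; Kesten 1987): well-separated
four-arm events across `Λ_{64q} ∖ Λ_{n₁}` and across `Λ_{n₃} ∖ Λ_{512(q+1)}` together with the four
rotated gluing events contain the four-arm event across `Λ_{n₃} ∖ Λ_{n₁}`: each arm is glued in its
own frame (`sepArmAt_glue_path`), the four glued arms live in pairwise disjoint zones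
(`glueZone_disjoint` for arms of the same colour, colours otherwise), hence are disjoint arms
(`mem_armEvent_four_of_disjointPaths`). [cite: Nolin2008, §4.3 Prop. 12 (arXiv 0711.4948: Prop. 11)] -/
theorem sepFourArm_glue_subset {q n₁ n₃ : ℕ} (hq : 1 ≤ q) (h4 : 4 ≤ n₁) (h₁ : n₁ ≤ 64 * q)
    (h₃ : 512 * (q + 1) ≤ n₃) :
    sepFourArm n₁ (64 * q) ∩ fourGlueFrames q ∩ sepFourArm (512 * (q + 1)) n₃ ⊆
      armEvent ![true, false, true, false] n₁ n₃ := by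
  rintro ω ⟨⟨⟨⟨X₀, X₃, hX03, hA₀, hA₃⟩, ⟨X₁, X₄, hX14, hA₁, hA₄⟩⟩, ⟨hG₀, hG₃⟩, hG₁, hG₄⟩,
    ⟨Y₀, Y₃, hY03, hB₀, hB₃⟩, ⟨Y₁, Y₄, hY14, hB₁, hB₄⟩⟩
  have P₀ := sepArmAt_glue_path hq h4 h₁ h₃ hA₀ hG₀ hB₀
  have P₃ := sepArmAt_glue_path hq h4 h₁ h₃ hA₃ hG₃ hB₃
  have P₁ := sepArmAt_glue_path hq h4 h₁ h₃ hA₁ hG₁ hB₁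
  have P₄ := sepArmAt_glue_path hq h4 h₁ h₃ hA₄ hG₄ hB₄
  have e : ∀ {i : ℕ} {X X' : Set (Site 2)} {b : Bool},
      glueZone q n₁ n₃ i X X' ∩ triAnnSet n₁ n₃ ∩ {v | v ∈ ω ↔ b} =
        (glueZone q n₁ n₃ i X X' ∩ {v | v ∈ ω ↔ b}) ∩ triAnnSet n₁ n₃ ∩ {v | v ∈ ω ↔ b} := by
    intro i X X' b; ext v; simp only [mem_inter_iff]; tauto
  rw [e] at P₀ P₃ P₁ P₄
  refine mem_armEvent_four_of_disjointPaths ?_ ?_ ?_ ?_ ?_ ?_ P₀ P₁ P₃ P₄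
  · exact disjoint_inter_colour (by decide)
  · exact Disjoint.mono inter_subset_left inter_subset_left
      (glueZone_disjoint hq (by norm_num) (by norm_num) (by norm_num) hX03 hY03)
  · exact disjoint_inter_colour (by decide)
  · exact disjoint_inter_colour (by decide)
  · exact Disjoint.mono inter_subset_left inter_subset_left
      (glueZone_disjoint hq (by norm_num) (by norm_num) (by norm_num) hX14 hY14)
  · exact disjoint_inter_colour (by decide)

/-- **Extending four arms** (Nolin 2008, Prop. 12 (i) [arXiv 0711.4948: Prop. 11],
extendability, `j = 4`, alternating colours): a well-separated four-arm event across
`Λ_{64q} ∖ Λ_{n₁}` together with the four rotated extension events contains the four-arm event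
across `Λ_{512(q+1)-1} ∖ Λ_{n₁}` (so the arms are extended by a factor `≥ 8`). [cite: Nolin2008, §4.3 Prop. 12 (arXiv 0711.4948: Prop. 11)] -/
theorem sepFourArm_glueExt_subset {q n₁ : ℕ} (hq : 1 ≤ q) (h4 : 4 ≤ n₁) (h₁ : n₁ ≤ 64 * q) :
    sepFourArm n₁ (64 * q) ∩ fourGlueExtFrames q ⊆
      armEvent ![true, false, true, false] n₁ (512 * (q + 1) - 1) := by
  rintro ω ⟨⟨⟨X₀, X₃, hX03, hA₀, hA₃⟩, ⟨X₁, X₄, hX14, hA₁, hA₄⟩⟩, ⟨hG₀, hG₃⟩, hG₁, hG₄⟩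
  set n₃ := 512 * (q + 1) with hn₃
  have P₀ := sepArmAt_glueExt_path n₃ hq h4 h₁ hA₀ hG₀
  have P₃ := sepArmAt_glueExt_path n₃ hq h4 h₁ hA₃ hG₃
  have P₁ := sepArmAt_glueExt_path n₃ hq h4 h₁ hA₁ hG₁
  have P₄ := sepArmAt_glueExt_path n₃ hq h4 h₁ hA₄ hG₄
  have e : ∀ {i : ℕ} {X : Set (Site 2)} {b : Bool},
      glueZone q n₁ n₃ i X ∅ ∩ triAnnSet n₁ (512 * (q + 1) - 1) ∩ {v | v ∈ ω ↔ b} =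
        (glueZone q n₁ n₃ i X ∅ ∩ {v | v ∈ ω ↔ b}) ∩ triAnnSet n₁ (512 * (q + 1) - 1) ∩ {v | v ∈ ω ↔ b} := by
    intro i X b; ext v; simp only [mem_inter_iff]; tauto
  rw [e] at P₀ P₃ P₁ P₄
  have hE : Disjoint (∅ : Set (Site 2)) ∅ := disjoint_bot_left
  refine mem_armEvent_four_of_disjointPaths ?_ ?_ ?_ ?_ ?_ ?_ P₀ P₁ P₃ P₄
  · exact disjoint_inter_colour (by decide)
  · exact Disjoint.mono inter_subset_left inter_subset_left
      (glueZone_disjoint hq (by norm_num) (by norm_num) (by norm_num) hX03 hE)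
  · exact disjoint_inter_colour (by decide)
  · exact disjoint_inter_colour (by decide)
  · exact Disjoint.mono inter_subset_left inter_subset_left
      (glueZone_disjoint hq (by norm_num) (by norm_num) (by norm_num) hX14 hE)
  · exact disjoint_inter_colour (by decide)

end Literature.Probability.Percolation

end
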